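import Literature.NumberTheory.LFunctions.ClassicalPsiErrorTerm
import Mathlib.MeasureTheory.Measure.Haar.NormedSpace
import Mathlib.Analysis.Convex.SpecificFunctions.Basic
import HarnessLib

/-!
# Landau's method with an exceptional zero: `ψ_Λ(x) = x − α x^β/β + O(x e^{−c₁√log x})`
# uniformly in a level parameter (Montgomery–Vaughan Theorem 11.16, Case 2)

Topic `Literature/NumberTheory/LFunctions`. Everything in this file is PROVED (theorems only).

`ClassicalPsiErrorTerm.lean` runs Landau's 1903 argument for a Dirichlet series with non-negative
coefficients `∑ Λ(n)n^{-s} = 1/(s − 1) + F(s)`, `F` holomorphic and `≪ log(|t|+4)` on the classical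
region `σ > 1 − c/log(|t| + 4)`. For the prime number theorem in arithmetic progressions to a
modulus `q` as large as `exp(C√log x)` (Montgomery–Vaughan, *Multiplicative Number Theory I*,
Theorem 11.16 and Corollary 11.17) two changes are needed, and this file makes exactly these:

* the region is `σ > 1 − c/(L + log(|t| + 4))` with a LEVEL PARAMETER `L ≥ 0` (`L = log q`; the
  shape `log q + log(|t|+4)` of MV Theorem 11.3 — with the tree's shape `c_q/log(|t|+4)`,
  `c_q ≍ 1/log q`, nothing survives at `log q ≍ √log x`);
* the Dirichlet series has a SECOND simple pole, `∑ Λ(n)n^{-s} = 1/(s−1) − α/(s−β) + F(s)` with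
  `1/2 ≤ β < 1`, `|α| ≤ 1` (MV (11.29): `β = β₁` the exceptional zero, `α = χ₁(a)`), and the bound
  for `F` is allowed to degenerate near `β`: `|F(s)| ≤ C log⁵(|t|+4)(1 + 1/|s − β|)` off `β`
  (`F` itself is holomorphic at `β`; the left edge of Landau's rectangle is simply chosen, among
  `1 − c/(2ℓ)` and `1 − c/(4ℓ)`, `ℓ = L + log(T + 4)`, at distance `≥ c/(8ℓ)` from `β` — this is
  the device of MV's proof of Theorem 11.16, Case 2, where the contour is kept away from `β₁`).

Under these hypotheses (`Literature.NumberTheory.LFunctions.ExcPsiData Λ F c C L β α`) we prove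

* `ExcPsiData.integral_betaTerm` — the contribution of the pole at `β` to the Riesz mean:
  `(1/2πi)∫_{(σ)} x^{1+s} ds/((s−β)s(s+1)) = x^{1+β}/(β(1+β)) − x/β + 1/(1+β)` (`x ≥ 1`);
* `ExcPsiData.exists_rieszMean_bound` — for `x ≥ 3` and `L ≤ 2√log x`,
  `|ψ₁(x) − (x−1)²/2 + α(x^{1+β}/(β(1+β)) − x/β + 1/(1+β))| ≤ A(c) C x² exp(−(c/40)√log x)`;
* `ExcPsiData.exists_psi_bound` — for `x ≥ 6` and `L ≤ √log x`,
  `|ψ_Λ(x) − x + α x^β/β| ≤ A(c) (C + 1) x exp(−(c/80)√log x)`,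

with `A(c)` depending only on `c` (so uniformly over families of data sharing `c`, which is how
`PagePNTWithExceptionalZeroProofs.lean` uses it for `Λ = φ(q)Λ𝟙_{≡ a (q)}`, all `q`).
This is MV Theorem 11.16, second case of (11.26)/(11.27) combined as in Cor. 11.17 (11.29), in
Landau's Riesz-mean normalisation (MV §5.1 (5.19)) used throughout the tree.

## References

* H. L. Montgomery, R. C. Vaughan, *Multiplicative Number Theory I. Classical Theory*, CUP 2007,
  §11.3, Theorem 11.16 (proof, Cases 1–2) and Corollary 11.17; §6.2 Theorem 6.9; §5.1 (5.19)
  (`MontgomeryVaughan2007`).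
* E. Landau, *Neuer Beweis des Primzahlsatzes und Beweis des Primidealsatzes*, Math. Ann. 56
  (1903), 645–670, §§5–8 (`LandauMathAnn1903`).
-/

noncomputable section

open Complex Filter Set MeasureTheory Real intervalIntegral
open scoped Topology Interval

namespace Literature.NumberTheory.LFunctions

open ClassicalPsiData

/-- **Hypotheses of Landau's method with an exceptional zero and a level parameter.**
`Λ ≥ 0`; `∑ Λ(n)n^{-s}` converges absolutely for `σ > 1` and equals `1/(s−1) − α/(s−β) + F(s)`
there; `F` is holomorphic on `σ > 1 − c/(L + log(|t|+4))` and satisfies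
`|F(s)| ≤ C log⁵(|t|+4) (1 + 1/|s − β|)` on that region off `β`; normalisations `0 < c ≤ 1/2`,
`0 ≤ C`, `0 ≤ L`, `1/2 ≤ β < 1`, `|α| ≤ 1`. Model: `Λ = φ(q)Λ𝟙_{n ≡ a (q)}`, `L = log q`,
`β = β₁`, `α = χ₁(a)`, `F = −∑_χ χ̄(a)L'/L(s,χ) − 1/(s−1) + χ₁(a)/(s−β₁)`
(MV (11.22) and Theorem 11.16, Case 2). [cite: MontgomeryVaughan2007, Theorem 11.16] -/
structure ExcPsiData (Λ : ℕ → ℝ) (F : ℂ → ℂ) (c C L β α : ℝ) : Prop where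
  /-- `0 < c`. -/
  c_pos : 0 < c
  /-- `c ≤ 1/2`. -/
  c_le : c ≤ 1 / 2
  /-- `0 ≤ C`. -/
  C_nonneg : 0 ≤ C
  /-- `0 ≤ L`. -/
  L_nonneg : 0 ≤ L
  /-- `1/2 ≤ β`. -/
  β_ge : 1 / 2 ≤ β
  /-- `β < 1`. -/
  β_lt : β < 1
  /-- `|α| ≤ 1`. -/
  α_le : |α| ≤ 1
  /-- `Λ ≥ 0`. -/
  nonneg : ∀ n, 0 ≤ Λ n
  /-- `∑ Λ(n) n^{-s}` converges absolutely for `σ > 1`. -/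
  summable : ∀ s : ℂ, 1 < s.re → LSeriesSummable (fun n ↦ (Λ n : ℂ)) s
  /-- `∑ Λ(n) n^{-s} = 1/(s − 1) − α/(s − β) + F(s)` for `σ > 1`. -/
  eq : ∀ s : ℂ, 1 < s.re →
    LSeries (fun n ↦ (Λ n : ℂ)) s = 1 / (s - 1) - (α : ℂ) / (s - (β : ℂ)) + F s
  /-- `F` is holomorphic on `σ > 1 − c/(L + log(|t| + 4))`. -/
  differentiableOn :
    DifferentiableOn ℂ F {s : ℂ | 1 - c / (L + Real.log (|s.im| + 4)) < s.re}
  /-- `|F(s)| ≤ C log⁵(|t| + 4)(1 + 1/|s − β|)` on the region, off `β`. -/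
  bound : ∀ s : ℂ, 1 - c / (L + Real.log (|s.im| + 4)) < s.re → s ≠ (β : ℂ) →
    ‖F s‖ ≤ C * Real.log (|s.im| + 4) ^ 5 * (1 + ‖s - (β : ℂ)‖⁻¹)

namespace ExcPsiData

/-! ## The region `σ > 1 − c/(L + log(|t| + 4))` -/

/-- The region `{s : σ > 1 − c/(L + log(|t| + 4))}` (MV Theorem 11.3 with `L = log q`).
[cite: MontgomeryVaughan2007, Theorem 11.3] -/
def zfrL (c L : ℝ) : Set ℂ := {s : ℂ | 1 - c / (L + Real.log (|s.im| + 4)) < s.re}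

/-- Membership in the region, unfolded. [folklore] -/
theorem mem_zfrL {c L : ℝ} {s : ℂ} :
    s ∈ zfrL c L ↔ 1 - c / (L + Real.log (|s.im| + 4)) < s.re := Iff.rfl

/-- `L + log(|t| + 4) ≥ 1` for `L ≥ 0`. [folklore] -/
theorem one_le_ellL {L : ℝ} (hL : 0 ≤ L) (t : ℝ) : 1 ≤ L + Real.log (|t| + 4) := by
  have := ClassicalZFRData.one_le_log_tau t; linarith

/-- `L + log(|t| + 4) > 0` for `L ≥ 0`. [folklore] -/
theorem ellL_pos {L : ℝ} (hL : 0 ≤ L) (t : ℝ) : 0 < L + Real.log (|t| + 4) :=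
  one_pos.trans_le (one_le_ellL hL t)

/-- The region is open. [folklore] -/
theorem isOpen_zfrL (c : ℝ) {L : ℝ} (hL : 0 ≤ L) : IsOpen (zfrL c L) := by
  have h1 : Continuous fun s : ℂ ↦ L + Real.log (|s.im| + 4) :=
    continuous_const.add (((continuous_abs.comp continuous_im).add continuous_const).log
      fun s ↦ (by positivity : (0 : ℝ) < |s.im| + 4).ne')
  have h2 : Continuous fun s : ℂ ↦ 1 - c / (L + Real.log (|s.im| + 4)) :=
    continuous_const.sub (continuous_const.div h1 fun s ↦ (ellL_pos hL _).ne')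
  exact isOpen_lt h2 continuous_re

/-- Points with `σ ≥ 1` lie in the region (`c > 0`). [folklore] -/
theorem mem_zfrL_of_one_le_re {c L : ℝ} (hc : 0 < c) (hL : 0 ≤ L) {s : ℂ} (hs : 1 ≤ s.re) :
    s ∈ zfrL c L := by
  rw [mem_zfrL]
  have : 0 < c / (L + Real.log (|s.im| + 4)) := div_pos hc (ellL_pos hL _)
  linarith

/-- A closed rectangle `σ ≥ 1 − c'/(L + log(T + 4))`, `|t| ≤ T` with `0 ≤ c' < c` lies in the
region. [folklore] -/
theorem mem_zfrL_of_rect {c c' L T : ℝ} (hc' : 0 ≤ c') (hc'c : c' < c) (hL : 0 ≤ L) {s : ℂ}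
    (hre : 1 - c' / (L + Real.log (T + 4)) ≤ s.re) (him : |s.im| ≤ T) : s ∈ zfrL c L := by
  rw [mem_zfrL]
  have hℓs : 0 < L + Real.log (|s.im| + 4) := ellL_pos hL _
  have hℓT : L + Real.log (|s.im| + 4) ≤ L + Real.log (T + 4) := by
    have := Real.log_le_log (by positivity : (0:ℝ) < |s.im| + 4) (by linarith : |s.im| + 4 ≤ T + 4)
    linarith
  have hTpos : 0 < L + Real.log (T + 4) := hℓs.trans_le hℓT
  have hc : 0 ≤ c := hc'.trans hc'c.le
  have h1 : c / (L + Real.log (T + 4)) ≤ c / (L + Real.log (|s.im| + 4)) :=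
    div_le_div_of_nonneg_left hc hℓs hℓT
  have h2 : c' / (L + Real.log (T + 4)) < c / (L + Real.log (T + 4)) :=
    div_lt_div_of_pos_right hc'c hTpos
  linarith

/-! ## The pole at `β`: the kernel `1/((s − β)s)` and the main term -/

/-- **Scaling `s = βw`**: for `0 < β < σ`, `x > 0` and real `t`,
`x^{σ+it}/((σ+it−β)(σ+it)) = β^{−2} · y^{w}/((w−1)w)` with `y = x^β`,
`w = σ/β + i t/β`. [folklore] -/
theorem cpow_mul_betaKernel_eq {β σ : ℝ} (hβ : 0 < β) {x : ℝ} (hx : 0 < x) (t : ℝ) :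
    (x : ℂ) ^ ((σ : ℂ) + t * I) * (1 / (((σ : ℂ) + t * I - β) * ((σ : ℂ) + t * I))) =
      ((β : ℂ) ^ 2)⁻¹ * ((((x ^ β : ℝ)) : ℂ) ^ ((((σ / β : ℝ)) : ℂ) + (((β⁻¹ * t : ℝ)) : ℂ) * I) *
        (1 / (((((σ / β : ℝ)) : ℂ) + (((β⁻¹ * t : ℝ)) : ℂ) * I - 1) *
          ((((σ / β : ℝ)) : ℂ) + (((β⁻¹ * t : ℝ)) : ℂ) * I)))) := by
  have hβC : (β : ℂ) ≠ 0 := ofReal_ne_zero.2 hβ.ne'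
  set s : ℂ := (σ : ℂ) + t * I with hs
  have hw : (((σ / β : ℝ)) : ℂ) + (((β⁻¹ * t : ℝ)) : ℂ) * I = (β : ℂ)⁻¹ * s := by
    rw [hs]; push_cast; field_simp
  have hpow : ((((x ^ β : ℝ)) : ℂ) ^ ((((σ / β : ℝ)) : ℂ) + (((β⁻¹ * t : ℝ)) : ℂ) * I)) =
      (x : ℂ) ^ s := by
    have him : (Complex.log (x : ℂ) * (β : ℂ)).im = 0 := by
      rw [← ofReal_log hx.le, ← ofReal_mul, ofReal_im]
    rw [hw, ofReal_cpow hx.le, ← cpow_mul _ (by rw [him]; exact neg_lt_zero.2 Real.pi_pos)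
      (by rw [him]; exact Real.pi_pos.le)]
    congr 1
    field_simp
  have hker : 1 / (((β : ℂ)⁻¹ * s - 1) * ((β : ℂ)⁻¹ * s)) = (β : ℂ) ^ 2 * (1 / ((s - β) * s)) := by
    have h1 : (β : ℂ)⁻¹ * s - 1 = (β : ℂ)⁻¹ * (s - β) := by field_simp
    rw [h1]
    simp only [one_div, mul_inv, inv_inv]
    ring
  rw [hpow, hw, hker]
  field_simp

/-- Integrability of `t ↦ x^{σ+it}/((σ+it−β)(σ+it))` for `0 < β < σ`, `x > 0` (by scaling from
`Literature.NumberTheory.LFunctions.RieszMean.integrable_cpow_mul_kernel_sub_one`). [folklore] -/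
theorem integrable_cpow_mul_betaKernel {β σ : ℝ} (hβ : 0 < β) (hσ : β < σ) {x : ℝ} (hx : 0 < x) :
    Integrable fun t : ℝ ↦ (x : ℂ) ^ ((σ : ℂ) + t * I) *
      (1 / (((σ : ℂ) + t * I - β) * ((σ : ℂ) + t * I))) := by
  have hy0 : 0 < x ^ β := Real.rpow_pos_of_pos hx β
  have hσ'1 : 1 < σ / β := by rw [lt_div_iff₀ hβ]; linarith
  have hf := RieszMean.integrable_cpow_mul_kernel_sub_one hσ'1 hy0
  have hf' := (hf.comp_mul_left' (inv_ne_zero hβ.ne')).const_mul (((β : ℂ) ^ 2)⁻¹)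
  refine hf'.congr (Eventually.of_forall fun t ↦ ?_)
  simp only
  rw [cpow_mul_betaKernel_eq hβ hx t]

/-- **The kernel of the pole at `β`**: for `0 < β < σ` and `x > 0`,
`(1/2π) ∫ x^{σ+it} dt/((σ+it−β)(σ+it)) = (x^β/β)(1 − x^{−β})⁺` — by the substitution `s = βw`
from the shifted Perron kernel `(1/2π)∫ y^{w} /((w−1)w) = y(1 − 1/y)⁺` with `y = x^β`.
[folklore] -/
theorem integral_cpow_mul_betaKernel {β σ : ℝ} (hβ : 0 < β) (hσ : β < σ) {x : ℝ} (hx : 0 < x) :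
    (1 / (2 * π) : ℂ) * ∫ t : ℝ, (x : ℂ) ^ ((σ : ℂ) + t * I) *
        (1 / (((σ : ℂ) + t * I - β) * ((σ : ℂ) + t * I))) =
      (((x ^ β / β) * max (1 - (x ^ β)⁻¹) 0 : ℝ) : ℂ) := by
  have hy0 : 0 < x ^ β := Real.rpow_pos_of_pos hx β
  have hσ'1 : 1 < σ / β := by rw [lt_div_iff₀ hβ]; linarith
  have h1 := RieszMean.integral_cpow_mul_kernel_sub_one hσ'1 hy0
  set f : ℝ → ℂ := fun u ↦ (((x ^ β : ℝ)) : ℂ) ^ ((((σ / β : ℝ)) : ℂ) + u * I) *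
    (1 / (((((σ / β : ℝ)) : ℂ) + u * I - 1) * ((((σ / β : ℝ)) : ℂ) + u * I))) with hf
  have hpt : ∀ t : ℝ, (x : ℂ) ^ ((σ : ℂ) + t * I) *
      (1 / (((σ : ℂ) + t * I - β) * ((σ : ℂ) + t * I))) = ((β : ℂ) ^ 2)⁻¹ * f (β⁻¹ * t) := by
    intro t
    rw [cpow_mul_betaKernel_eq hβ hx t]
  calc (1 / (2 * π) : ℂ) * ∫ t : ℝ, (x : ℂ) ^ ((σ : ℂ) + t * I) *
        (1 / (((σ : ℂ) + t * I - β) * ((σ : ℂ) + t * I)))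
      = (1 / (2 * π) : ℂ) * ∫ t : ℝ, ((β : ℂ) ^ 2)⁻¹ * f (β⁻¹ * t) := by
        congr 1; exact integral_congr_ae (Eventually.of_forall hpt)
    _ = ((β : ℂ) ^ 2)⁻¹ * ((|β| : ℝ) : ℂ) * ((1 / (2 * π) : ℂ) * ∫ u : ℝ, f u) := by
        rw [MeasureTheory.integral_const_mul, Measure.integral_comp_inv_mul_left f β, Complex.real_smul]; ring
    _ = ((β : ℂ) ^ 2)⁻¹ * ((|β| : ℝ) : ℂ) *
          ((((x ^ β : ℝ)) : ℂ) * ((max (1 - (x ^ β)⁻¹) 0 : ℝ) : ℂ)) := by rw [h1]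
    _ = (((x ^ β / β) * max (1 - (x ^ β)⁻¹) 0 : ℝ) : ℂ) := by
        have hβC : (β : ℂ) ≠ 0 := ofReal_ne_zero.2 hβ.ne'
        rw [abs_of_pos hβ]
        push_cast
        field_simp

/-- Integrability on `Re s = σ > β` of `x^{1+s}/((s − β)s(s+1))` (`x > 0`, `0 < β`). [folklore] -/
theorem integrable_cpow_mul_betaPolar_mul_kernel {x : ℝ} (hx : 0 < x) {β σ : ℝ} (hβ : 0 < β)
    (hσ : β < σ) :
    Integrable fun t : ℝ ↦ (x : ℂ) ^ (1 + ((σ : ℂ) + t * I)) * (1 / ((σ : ℂ) + t * I - β)) *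
      kernel ((σ : ℂ) + t * I) := by
  have hx0 : (x : ℂ) ≠ 0 := ofReal_ne_zero.2 hx.ne'
  have hσ0 : 0 < σ := hβ.trans hσ
  have hne : ∀ t : ℝ, (σ : ℂ) + t * I - β ≠ 0 := fun t h ↦ by
    have := congrArg Complex.re h; simp at this; linarith
  refine (Literature.NumberTheory.LFunctions.integrable_kernel hσ0).bdd_mul
    (c := x ^ (1 + σ) / (σ - β)) ?_ (Eventually.of_forall fun t ↦ ?_)
  · refine Continuous.aestronglyMeasurable (Continuous.mul ?_ ?_)
    · refine continuous_iff_continuousAt.2 fun t ↦ ?_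
      exact (continuousAt_const_cpow hx0).comp (f := fun t : ℝ ↦ 1 + ((σ : ℂ) + t * I))
        (by fun_prop)
    · exact continuous_const.div (by fun_prop) hne
  · have hre : ((σ : ℂ) + t * I - β).re = σ - β := by simp
    have hnorm : σ - β ≤ ‖(σ : ℂ) + t * I - β‖ := by
      calc σ - β = ((σ : ℂ) + t * I - β).re := hre.symm
        _ ≤ _ := re_le_norm _
    have h1σ : (1 + ((σ : ℂ) + t * I)).re = 1 + σ := by simp
    rw [norm_mul, norm_div, norm_one, norm_cpow_eq_rpow_re_of_pos hx, h1σ,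
      div_eq_mul_one_div (x ^ (1 + σ))]
    exact mul_le_mul_of_nonneg_left (one_div_le_one_div_of_le (by linarith) hnorm)
      (by positivity)

/-- The main term produced by the pole at `β`:
`M_β(x) = x^{1+β}/(β(1+β)) − x/β + 1/(1+β)` (`= ∫₁ˣ (u^β − 1)/β du`, the Riesz mean of
`(u^β − 1)/β`). [cite: MontgomeryVaughan2007, Theorem 11.16] -/
def betaMain (β x : ℝ) : ℝ := x ^ (1 + β) / (β * (1 + β)) - x / β + 1 / (1 + β)

/-- **The main term of the pole at `β`.** For `x ≥ 1`, `0 < β < 1` and `σ > 1`,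
`(1/2π) ∫ x^{1+s} /((s−β) s (s+1)) dt = x^{1+β}/(β(1+β)) − x/β + 1/(1+β)`, `s = σ + it`; from
`1/((s−β)s(s+1)) = (1/(1+β))(1/((s−β)s) − 1/(s(s+1)))` and the two kernel evaluations.
[cite: MontgomeryVaughan2007, §5.1 (5.19)] -/
theorem integral_betaTerm {x : ℝ} (hx : 1 ≤ x) {β : ℝ} (hβ0 : 0 < β) (hβ1 : β < 1) {σ : ℝ}
    (hσ : 1 < σ) :
    (1 / (2 * π) : ℂ) * ∫ t : ℝ, (x : ℂ) ^ (1 + ((σ : ℂ) + t * I)) * (1 / ((σ : ℂ) + t * I - β)) *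
        (1 / (((σ : ℂ) + t * I) * ((σ : ℂ) + t * I + 1))) = ((betaMain β x : ℝ) : ℂ) := by
  have hx0' : 0 < x := by linarith
  have hx0 : (x : ℂ) ≠ 0 := ofReal_ne_zero.2 hx0'.ne'
  have hσ0 : 0 < σ := by linarith
  have hβσ : β < σ := by linarith
  set A : ℝ → ℂ := fun t ↦ (x : ℂ) ^ ((σ : ℂ) + t * I) *
    (1 / (((σ : ℂ) + t * I - β) * ((σ : ℂ) + t * I))) with hA
  set B : ℝ → ℂ := fun t ↦ (x : ℂ) ^ ((σ : ℂ) + t * I) *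
    (1 / (((σ : ℂ) + t * I) * ((σ : ℂ) + t * I + 1))) with hB
  have hne : ∀ t : ℝ, ((σ : ℂ) + t * I - β) ≠ 0 ∧ ((σ : ℂ) + t * I) ≠ 0 ∧
      ((σ : ℂ) + t * I + 1) ≠ 0 := by
    intro t
    refine ⟨fun h ↦ ?_, fun h ↦ ?_, fun h ↦ ?_⟩ <;>
    · have := congrArg Complex.re h
      simp at this
      linarith
  have h1β : (1 + (β : ℂ)) ≠ 0 := by
    intro h; have := congrArg Complex.re h; simp at this; linarith
  have hpt : ∀ t : ℝ, (x : ℂ) ^ (1 + ((σ : ℂ) + t * I)) * (1 / ((σ : ℂ) + t * I - β)) *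
      (1 / (((σ : ℂ) + t * I) * ((σ : ℂ) + t * I + 1))) = ((x : ℂ) / (1 + β)) * (A t - B t) := by
    intro t
    obtain ⟨h1, h2, h3⟩ := hne t
    simp only [hA, hB]
    rw [cpow_add _ _ hx0, cpow_one]
    field_simp
    ring
  have hIA := integral_cpow_mul_betaKernel hβ0 hβσ hx0'
  have hIB := RieszMean.integral_cpow_mul_kernel hσ0 hx0'
  have hintA := integrable_cpow_mul_betaKernel hβ0 hβσ hx0'
  have hintB := RieszMean.integrable_cpow_mul_kernel hσ0 hx0'
  rw [integral_congr_ae (Eventually.of_forall hpt), MeasureTheory.integral_const_mul, integral_sub hintA hintB]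
  simp only [← hA, ← hB] at hIA hIB ⊢
  have hxβ1 : 1 ≤ x ^ β := Real.one_le_rpow hx hβ0.le
  have hm1 : max (1 - (x ^ β)⁻¹) 0 = 1 - (x ^ β)⁻¹ :=
    max_eq_left (by rw [sub_nonneg]; exact inv_le_one_of_one_le₀ hxβ1)
  have hm2 : max (1 - x⁻¹) 0 = 1 - x⁻¹ :=
    max_eq_left (by rw [sub_nonneg]; exact inv_le_one_of_one_le₀ hx)
  calc (1 / (2 * π) : ℂ) * ((x : ℂ) / (1 + β) * ((∫ a, A a) - ∫ a, B a))
      = (x : ℂ) / (1 + β) * ((1 / (2 * π) : ℂ) * (∫ a, A a) - (1 / (2 * π) : ℂ) * ∫ a, B a) := by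
        ring
    _ = (x : ℂ) / (1 + β) * ((((x ^ β / β) * max (1 - (x ^ β)⁻¹) 0 : ℝ) : ℂ) -
          ((max (1 - x⁻¹) 0 : ℝ) : ℂ)) := by rw [hIA, hIB]
    _ = ((betaMain β x : ℝ) : ℂ) := by
        rw [hm1, hm2, betaMain, Real.rpow_add hx0', Real.rpow_one]
        have hY : (((x ^ β : ℝ)) : ℂ) ≠ 0 := ofReal_ne_zero.2 (by positivity)
        have hb : (β : ℂ) ≠ 0 := ofReal_ne_zero.2 hβ0.ne'
        push_cast
        field_simp
        ring

/-! ## Perron's formula with both main terms removed -/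

variable {Λ : ℕ → ℝ} {F : ℂ → ℂ} {c C L β α : ℝ}

/-- `0 < β`. [folklore] -/
theorem β_pos (h : ExcPsiData Λ F c C L β α) : 0 < β := by linarith [h.β_ge]

/-- Integrability on `Re s = σ > 1` of `Φ_x(s) = x^{1+s} F(s)/(s(s+1))` under `ExcPsiData`
(difference of the Perron integrand and the two polar integrands). [folklore] -/
theorem integrable_Phi (h : ExcPsiData Λ F c C L β α) {x : ℝ} (hx : 0 < x) {σ : ℝ} (hσ : 1 < σ) :
    Integrable fun t : ℝ ↦ Phi F x (σ + t * I) := by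
  have hs : LSeriesSummable (fun n ↦ (Λ n : ℂ)) (σ : ℂ) := h.summable _ (by simp [hσ])
  have h1 := integrable_cpow_mul_LSeries_mul_kernel _ hx (by linarith) hs
  have h2 := integrable_cpow_mul_polar_mul_kernel hx hσ
  have h3 := (integrable_cpow_mul_betaPolar_mul_kernel hx h.β_pos (by linarith [h.β_lt])
    (σ := σ)).const_mul (α : ℂ)
  refine ((h1.sub h2).add h3).congr (Eventually.of_forall fun t ↦ ?_)
  simp only [Phi, Pi.add_apply, Pi.sub_apply]
  rw [h.eq _ (by simp [hσ])]
  ring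

/-- **Perron's formula for `ψ₁` with both main terms removed** (Landau 1903 §5; MV (5.19) and
Theorem 11.16): for `x ≥ 1` and `σ > 1`,
`ψ₁(x) − (x − 1)²/2 + α M_β(x) = (1/2π) ∫ x^{1+s} F(s)/(s(s+1)) dt`, `s = σ + it`.
[cite: MontgomeryVaughan2007, Theorem 11.16] -/
theorem rieszMean_sub_mainTerms_eq (h : ExcPsiData Λ F c C L β α) {x : ℝ} (hx : 1 ≤ x) {σ : ℝ}
    (hσ : 1 < σ) :
    ((∑ n ∈ Finset.Ioc 0 ⌊x⌋₊, Λ n * (x - n) : ℝ) : ℂ) - ((((x - 1) ^ 2 / 2 : ℝ)) : ℂ) +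
        (α : ℂ) * ((betaMain β x : ℝ) : ℂ) =
      (1 / (2 * π) : ℂ) * ∫ t : ℝ, Phi F x (σ + t * I) := by
  have hx0 : 0 < x := by linarith
  have hs : LSeriesSummable (fun n ↦ (Λ n : ℂ)) (σ : ℂ) := h.summable _ (by simp [hσ])
  have hint1 := integrable_cpow_mul_LSeries_mul_kernel (fun n ↦ (Λ n : ℂ)) hx0 (by linarith) hs
  have hint2 := integrable_cpow_mul_polar_mul_kernel hx0 hσ
  have hint3 := integrable_cpow_mul_betaPolar_mul_kernel hx0 h.β_pos (by linarith [h.β_lt])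
    (σ := σ)
  have hI4 : ∫ t : ℝ, Phi F x (σ + t * I) =
      (∫ t : ℝ, (x : ℂ) ^ (1 + ((σ : ℂ) + t * I)) * LSeries (fun n ↦ (Λ n : ℂ)) (σ + t * I) *
          kernel ((σ : ℂ) + t * I)) -
        (∫ t : ℝ, (x : ℂ) ^ (1 + ((σ : ℂ) + t * I)) * (1 / ((σ : ℂ) + t * I - 1)) *
          kernel ((σ : ℂ) + t * I)) +
        (α : ℂ) * ∫ t : ℝ, (x : ℂ) ^ (1 + ((σ : ℂ) + t * I)) * (1 / ((σ : ℂ) + t * I - β)) *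
          kernel ((σ : ℂ) + t * I) := by
    have hfun : (fun t : ℝ ↦ Phi F x (σ + t * I)) = fun t : ℝ ↦
        ((x : ℂ) ^ (1 + ((σ : ℂ) + t * I)) * LSeries (fun n ↦ (Λ n : ℂ)) (σ + t * I) *
            kernel ((σ : ℂ) + t * I) -
          (x : ℂ) ^ (1 + ((σ : ℂ) + t * I)) * (1 / ((σ : ℂ) + t * I - 1)) *
            kernel ((σ : ℂ) + t * I)) +
        (α : ℂ) * ((x : ℂ) ^ (1 + ((σ : ℂ) + t * I)) * (1 / ((σ : ℂ) + t * I - β)) *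
          kernel ((σ : ℂ) + t * I)) := by
      funext t
      simp only [Phi]
      rw [h.eq _ (by simp [hσ])]
      ring
    have hint12 : Integrable fun t : ℝ ↦
        (x : ℂ) ^ (1 + ((σ : ℂ) + t * I)) * LSeries (fun n ↦ (Λ n : ℂ)) (σ + t * I) *
            kernel ((σ : ℂ) + t * I) -
          (x : ℂ) ^ (1 + ((σ : ℂ) + t * I)) * (1 / ((σ : ℂ) + t * I - 1)) *
            kernel ((σ : ℂ) + t * I) := hint1.sub hint2
    rw [hfun, integral_add hint12 (hint3.const_mul _), integral_sub hint1 hint2,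
      MeasureTheory.integral_const_mul]
  rw [RieszMean.sum_mul_sub_eq_integral_LSeries_real Λ hx0 (by linarith) hs,
    ← RieszMean.integral_mainTerm hx hσ, ← integral_betaTerm hx h.β_pos h.β_lt hσ, hI4]
  simp only [kernel]
  ring

/-! ## Moving the segment `[σ₀ − iT, σ₀ + iT]` to `Re s = σ₁` -/

/-- **Cauchy's theorem on the rectangle `[σ₁, σ₀] × [−T, T]`** inside the region (no residue:
`F` is holomorphic at `β`): the line integral over `Re s = σ₀` equals the two tails `|t| ≥ T`,
plus the integral over `Re s = σ₁`, plus `i` times (bottom side minus top side).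
[cite: LandauMathAnn1903, §6] -/
theorem integral_line_eq (h : ExcPsiData Λ F c C L β α) {x : ℝ} (hx : 0 < x) {σ₀ σ₁ T c' : ℝ}
    (hc' : 0 ≤ c') (hc'c : c' < c) (hT : 0 < T) (hσ₁ : 0 < σ₁) (hσ₁₀ : σ₁ ≤ σ₀)
    (hσ₁c : 1 - c' / (L + Real.log (T + 4)) ≤ σ₁)
    (hint : Integrable fun t : ℝ ↦ Phi F x (σ₀ + t * I)) :
    ∫ t : ℝ, Phi F x (σ₀ + t * I) =
      (∫ t in Iic (-T), Phi F x (σ₀ + t * I)) + (∫ t in Ioi T, Phi F x (σ₀ + t * I)) +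
      (∫ t in (-T)..T, Phi F x (σ₁ + t * I)) +
      I * (∫ u in σ₁..σ₀, Phi F x (u + (-T) * I)) - I * (∫ u in σ₁..σ₀, Phi F x (u + T * I)) := by
  have hL := h.L_nonneg
  have hsplit1 := integral_Iic_add_Ioi (b := -T) hint.integrableOn hint.integrableOn
  have hsplit2 := integral_interval_add_Ioi (a := -T) (b := T) hint.integrableOn hint.integrableOn
  have hdiff : DifferentiableOn ℂ (Phi F x) (uIcc σ₁ σ₀ ×ℂ uIcc (-T) T) := by
    intro s hs
    rw [uIcc_of_le hσ₁₀, uIcc_of_le (by linarith : -T ≤ T)] at hs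
    obtain ⟨⟨hre1, -⟩, him1, him2⟩ := hs
    have hsz : s ∈ zfrL c L :=
      mem_zfrL_of_rect hc' hc'c hL (hσ₁c.trans hre1) (abs_le.2 ⟨him1, him2⟩)
    exact (differentiableAt_Phi hx (h.differentiableOn.differentiableAt
      ((isOpen_zfrL c hL).mem_nhds hsz)) (hσ₁.trans_le hre1)).differentiableWithinAt
  have H := Complex.integral_boundary_rect_eq_zero_of_differentiableOn (Phi F x) ⟨σ₁, -T⟩ ⟨σ₀, T⟩
    hdiff
  dsimp only at H
  simp only [smul_eq_mul, ofReal_neg, neg_mul] at H ⊢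
  have key : (∫ y : ℝ in (-T)..T, Phi F x (σ₀ + y * I)) =
      (∫ y : ℝ in (-T)..T, Phi F x (σ₁ + y * I)) +
        I * (∫ u : ℝ in σ₁..σ₀, Phi F x (u + -(T * I))) -
        I * (∫ u : ℝ in σ₁..σ₀, Phi F x (u + T * I)) := by
    have hI : I * I = -1 := I_mul_I
    linear_combination (-I) * H +
      ((∫ y : ℝ in (-T)..T, Phi F x (σ₀ + y * I)) -
        (∫ y : ℝ in (-T)..T, Phi F x (σ₁ + y * I))) * hI
  rw [← hsplit1, ← hsplit2, key]
  ring

/-! ## Bounds for the five pieces -/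

/-- `‖F(s)‖ ≤ C log⁵(|t|+4)(1 + 1/δ)` for `s` in the region at distance `≥ δ > 0` from `β`.
[folklore] -/
theorem norm_F_le (h : ExcPsiData Λ F c C L β α) {s : ℂ} (hs : s ∈ zfrL c L) {δ : ℝ}
    (hδ : 0 < δ) (hd : δ ≤ ‖s - (β : ℂ)‖) :
    ‖F s‖ ≤ C * Real.log (|s.im| + 4) ^ 5 * (1 + δ⁻¹) := by
  have hsβ : s ≠ (β : ℂ) := by
    intro h'; rw [h', sub_self, norm_zero] at hd; linarith
  refine (h.bound s hs hsβ).trans ?_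
  have hlog : 0 ≤ Real.log (|s.im| + 4) ^ 5 := pow_nonneg (ClassicalZFRData.log_tau_pos _).le 5
  have hinv : ‖s - (β : ℂ)‖⁻¹ ≤ δ⁻¹ := inv_anti₀ hδ hd
  have hCL : 0 ≤ C * Real.log (|s.im| + 4) ^ 5 := mul_nonneg h.C_nonneg hlog
  exact mul_le_mul_of_nonneg_left (by linarith) hCL

/-- `log(|t| + 4)⁵ ≤ 250000 |t|^{1/2}` for `|t| ≥ 1` (crude: `log u ≤ 10 u^{1/10}`). [folklore] -/
theorem log_tau_pow_five_le {t : ℝ} (ht : 1 ≤ |t|) :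
    Real.log (|t| + 4) ^ 5 ≤ 250000 * |t| ^ (1 / 2 : ℝ) := by
  have h0 : 0 ≤ Real.log (|t| + 4) := (ClassicalZFRData.log_tau_pos t).le
  have h1 : Real.log (|t| + 4) ≤ (|t| + 4) ^ (1 / 10 : ℝ) / (1 / 10) :=
    Real.log_le_rpow_div (by positivity) (by norm_num)
  have h2 : (|t| + 4) ^ (1 / 10 : ℝ) ≤ (5 * |t|) ^ (1 / 10 : ℝ) :=
    Real.rpow_le_rpow (by positivity) (by linarith) (by norm_num)
  have h3 : Real.log (|t| + 4) ≤ 10 * (5 * |t|) ^ (1 / 10 : ℝ) := by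
    rw [div_div_eq_mul_div, div_one] at h1
    linarith
  have h4 : Real.log (|t| + 4) ^ 5 ≤ (10 * (5 * |t|) ^ (1 / 10 : ℝ)) ^ 5 :=
    pow_le_pow_left₀ h0 h3 5
  have h5 : ((5 * |t|) ^ (1 / 10 : ℝ)) ^ 5 = (5 * |t|) ^ (1 / 2 : ℝ) := by
    rw [← Real.rpow_mul_natCast (by positivity)]; norm_num
  have h6 : (5 * |t|) ^ (1 / 2 : ℝ) = (5:ℝ) ^ (1 / 2 : ℝ) * |t| ^ (1 / 2 : ℝ) :=
    Real.mul_rpow (by norm_num) (abs_nonneg t)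
  have h7 : (5:ℝ) ^ (1 / 2 : ℝ) ≤ 5 / 2 := by
    rw [← Real.sqrt_eq_rpow, Real.sqrt_le_left (by norm_num)]; norm_num
  have h8 : 0 ≤ |t| ^ (1 / 2 : ℝ) := by positivity
  calc Real.log (|t| + 4) ^ 5 ≤ (10 * (5 * |t|) ^ (1 / 10 : ℝ)) ^ 5 := h4
    _ = 100000 * (5 * |t|) ^ (1 / 2 : ℝ) := by rw [mul_pow, h5]; norm_num
    _ = 100000 * (5:ℝ) ^ (1 / 2 : ℝ) * |t| ^ (1 / 2 : ℝ) := by rw [h6]; ring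
    _ ≤ 100000 * (5 / 2) * |t| ^ (1 / 2 : ℝ) := by gcongr
    _ = 250000 * |t| ^ (1 / 2 : ℝ) := by norm_num

/-- **Pointwise bound on the line `Re s = σ₀ > 1` for `|t| ≥ 1`** (there `|s − β| ≥ σ₀ − 1`):
`‖Φ_x(σ₀ + it)‖ ≤ 250000 C (1 + 1/(σ₀−1)) x^{1+σ₀} |t|^{−3/2}` (`x ≥ 1`). [folklore] -/
theorem norm_Phi_le_tail (h : ExcPsiData Λ F c C L β α) {x : ℝ} (hx : 1 ≤ x) {σ₀ : ℝ}
    (hσ₀ : 1 < σ₀) {t : ℝ} (ht : 1 ≤ |t|) :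
    ‖Phi F x (σ₀ + t * I)‖ ≤
      250000 * C * (1 + (σ₀ - 1)⁻¹) * x ^ (1 + σ₀) * |t| ^ (-(3 / 2 : ℝ)) := by
  have hx0 : 0 < x := by linarith
  have ht0 : 0 < |t| := by linarith
  have htne : t ≠ 0 := abs_pos.1 ht0
  have hL := h.L_nonneg
  have hC := h.C_nonneg
  have hmem : ((σ₀ : ℂ) + t * I) ∈ zfrL c L :=
    mem_zfrL_of_one_le_re h.c_pos hL (by simp [hσ₀.le])
  have hδ : 0 < σ₀ - 1 := by linarith
  have hδ' : 0 ≤ 1 + (σ₀ - 1)⁻¹ := by positivity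
  have hdist : σ₀ - 1 ≤ ‖((σ₀ : ℂ) + t * I) - (β : ℂ)‖ := by
    have hre : (((σ₀ : ℂ) + t * I) - (β : ℂ)).re = σ₀ - β := by simp
    calc σ₀ - 1 ≤ σ₀ - β := by linarith [h.β_lt]
      _ = (((σ₀ : ℂ) + t * I) - (β : ℂ)).re := hre.symm
      _ ≤ _ := re_le_norm _
  have hF := h.norm_F_le hmem hδ hdist
  have him : ((σ₀ : ℂ) + t * I).im = t := by simp
  rw [him] at hF
  have hlt := log_tau_pow_five_le ht
  have hF' : ‖F (σ₀ + t * I)‖ ≤ C * (250000 * |t| ^ (1 / 2 : ℝ)) * (1 + (σ₀ - 1)⁻¹) := by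
    refine hF.trans ?_
    gcongr
  have hK : ‖kernel (σ₀ + t * I)‖ ≤ |t| ^ (-(2 : ℝ)) := by
    refine (norm_kernel_le_inv_sq (s := σ₀ + t * I) (by simpa using htne)).trans (le_of_eq ?_)
    rw [him, Real.rpow_neg (abs_nonneg t), Real.rpow_two, sq_abs, one_div]
  rw [norm_Phi_eq F hx0]
  have hre : ((σ₀ : ℂ) + t * I).re = σ₀ := by simp
  rw [hre]
  have hsplit : |t| ^ (-(3 / 2 : ℝ)) = |t| ^ (1 / 2 : ℝ) * |t| ^ (-(2 : ℝ)) := by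
    rw [← Real.rpow_add ht0]; norm_num
  calc x ^ (1 + σ₀) * ‖F (σ₀ + t * I)‖ * ‖kernel (σ₀ + t * I)‖
      ≤ x ^ (1 + σ₀) * (C * (250000 * |t| ^ (1 / 2 : ℝ)) * (1 + (σ₀ - 1)⁻¹)) *
          |t| ^ (-(2 : ℝ)) := by gcongr
    _ = 250000 * C * (1 + (σ₀ - 1)⁻¹) * x ^ (1 + σ₀) * |t| ^ (-(3 / 2 : ℝ)) := by
        rw [hsplit]; ring

/-- **The upper tail**: `‖∫_T^∞ Φ_x(σ₀ + it) dt‖ ≤ 500000 C (1 + 1/(σ₀−1)) x^{1+σ₀} T^{−1/2}`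
for `T ≥ 1`. [cite: LandauMathAnn1903, §6] -/
theorem norm_integral_Ioi_le (h : ExcPsiData Λ F c C L β α) {x : ℝ} (hx : 1 ≤ x) {σ₀ : ℝ}
    (hσ₀ : 1 < σ₀) {T : ℝ} (hT : 1 ≤ T) :
    ‖∫ t in Ioi T, Phi F x (σ₀ + t * I)‖ ≤
      500000 * C * (1 + (σ₀ - 1)⁻¹) * x ^ (1 + σ₀) * T ^ (-(1 / 2 : ℝ)) := by
  have hT0 : 0 < T := by linarith
  set g : ℝ → ℝ := fun t ↦ 250000 * C * (1 + (σ₀ - 1)⁻¹) * x ^ (1 + σ₀) * t ^ (-(3 / 2 : ℝ))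
    with hg
  have hgi : IntegrableOn g (Ioi T) :=
    (integrableOn_Ioi_rpow_of_lt (by norm_num : (-(3 / 2 : ℝ)) < -1) hT0).const_mul _
  have hbound : ∀ᵐ t : ℝ ∂(volume.restrict (Ioi T)), ‖Phi F x (σ₀ + t * I)‖ ≤ g t := by
    refine (ae_restrict_iff' measurableSet_Ioi).2 (Eventually.of_forall fun t (ht : T < t) ↦ ?_)
    have ht1 : 1 ≤ |t| := by rw [abs_of_pos (hT0.trans ht)]; linarith
    have := h.norm_Phi_le_tail hx hσ₀ ht1
    rwa [abs_of_pos (hT0.trans ht)] at this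
  refine (norm_integral_le_of_norm_le hgi hbound).trans (le_of_eq ?_)
  rw [hg, MeasureTheory.integral_const_mul, integral_Ioi_rpow_of_lt (by norm_num) hT0]
  have : (-(3 / 2 : ℝ)) + 1 = -(1 / 2 : ℝ) := by norm_num
  rw [this]
  ring

/-- **The lower tail**: `‖∫_{−∞}^{−T} Φ_x(σ₀ + it) dt‖ ≤ 500000 C (1 + 1/(σ₀−1)) x^{1+σ₀} T^{−1/2}`
for `T ≥ 1` (reflect `t ↦ −t`). [cite: LandauMathAnn1903, §6] -/
theorem norm_integral_Iic_le (h : ExcPsiData Λ F c C L β α) {x : ℝ} (hx : 1 ≤ x) {σ₀ : ℝ}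
    (hσ₀ : 1 < σ₀) {T : ℝ} (hT : 1 ≤ T) :
    ‖∫ t in Iic (-T), Phi F x (σ₀ + t * I)‖ ≤
      500000 * C * (1 + (σ₀ - 1)⁻¹) * x ^ (1 + σ₀) * T ^ (-(1 / 2 : ℝ)) := by
  have hT0 : 0 < T := by linarith
  rw [← integral_comp_neg_Ioi]
  set g : ℝ → ℝ := fun t ↦ 250000 * C * (1 + (σ₀ - 1)⁻¹) * x ^ (1 + σ₀) * t ^ (-(3 / 2 : ℝ))
    with hg
  have hgi : IntegrableOn g (Ioi T) :=
    (integrableOn_Ioi_rpow_of_lt (by norm_num : (-(3 / 2 : ℝ)) < -1) hT0).const_mul _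
  have hbound : ∀ᵐ t : ℝ ∂(volume.restrict (Ioi T)),
      ‖Phi F x (σ₀ + ((-t : ℝ) : ℂ) * I)‖ ≤ g t := by
    refine (ae_restrict_iff' measurableSet_Ioi).2 (Eventually.of_forall fun t (ht : T < t) ↦ ?_)
    have ht1 : 1 ≤ |(-t)| := by rw [abs_neg, abs_of_pos (hT0.trans ht)]; linarith
    have := h.norm_Phi_le_tail hx hσ₀ ht1
    rwa [abs_neg, abs_of_pos (hT0.trans ht)] at this
  refine (norm_integral_le_of_norm_le hgi hbound).trans (le_of_eq ?_)
  rw [hg, MeasureTheory.integral_const_mul, integral_Ioi_rpow_of_lt (by norm_num) hT0]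
  have : (-(3 / 2 : ℝ)) + 1 = -(1 / 2 : ℝ) := by norm_num
  rw [this]
  ring

/-- **The horizontal sides** `[σ₁, σ₀] × {±T}`, `T ≥ 1` (there `|s − β| ≥ T ≥ 1`):
`‖∫_{σ₁}^{σ₀} Φ_x(u ± iT) du‖ ≤ 2C log⁵(T+4) x^{1+σ₀} (σ₀ − σ₁)/T²`. [cite: LandauMathAnn1903, §6] -/
theorem norm_integral_horizontal_le (h : ExcPsiData Λ F c C L β α) {x : ℝ} (hx : 1 ≤ x)
    {σ₀ σ₁ T c' : ℝ} (hc' : 0 ≤ c') (hc'c : c' < c) (hT : 1 ≤ T) (hσ₁₀ : σ₁ ≤ σ₀)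
    (hσ₁c : 1 - c' / (L + Real.log (T + 4)) ≤ σ₁) {T' : ℝ} (hT' : |T'| = T) :
    ‖∫ u in σ₁..σ₀, Phi F x (u + T' * I)‖ ≤
      2 * C * Real.log (T + 4) ^ 5 * x ^ (1 + σ₀) / T ^ 2 * (σ₀ - σ₁) := by
  have hx0 : 0 < x := by linarith
  have hT0 : 0 < T := by linarith
  have hL := h.L_nonneg
  have hC := h.C_nonneg
  have hlog : 0 ≤ Real.log (T + 4) := Real.log_nonneg (by linarith)
  have hT'0 : T' ≠ 0 := by rintro rfl; simp at hT'; linarith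
  have hb : ∀ u ∈ Ι σ₁ σ₀, ‖Phi F x (u + T' * I)‖ ≤
      2 * C * Real.log (T + 4) ^ 5 * x ^ (1 + σ₀) / T ^ 2 := by
    intro u hu
    rw [uIoc_of_le hσ₁₀] at hu
    have him : ((u : ℂ) + T' * I).im = T' := by simp
    have hre : ((u : ℂ) + T' * I).re = u := by simp
    have hmem : ((u : ℂ) + T' * I) ∈ zfrL c L :=
      mem_zfrL_of_rect hc' hc'c hL (by rw [hre]; linarith [hu.1]) (by rw [him, hT'])
    have hdist : (1 : ℝ) ≤ ‖((u : ℂ) + T' * I) - (β : ℂ)‖ := by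
      have h1 : |(((u : ℂ) + T' * I) - (β : ℂ)).im| ≤ ‖((u : ℂ) + T' * I) - (β : ℂ)‖ :=
        abs_im_le_norm _
      have h2 : (((u : ℂ) + T' * I) - (β : ℂ)).im = T' := by simp
      rw [h2, hT'] at h1
      linarith
    have hF := h.norm_F_le hmem one_pos hdist
    rw [him, hT', inv_one] at hF
    have hF' : ‖F (u + T' * I)‖ ≤ 2 * C * Real.log (T + 4) ^ 5 := by linarith
    have hK : ‖kernel (u + T' * I)‖ ≤ 1 / T ^ 2 := by
      have := norm_kernel_le_inv_sq (s := u + T' * I) (by rw [him]; exact hT'0)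
      rwa [him, ← sq_abs, hT'] at this
    have hxu : x ^ (1 + u) ≤ x ^ (1 + σ₀) :=
      Real.rpow_le_rpow_of_exponent_le hx (by linarith [hu.2])
    rw [norm_Phi_eq F hx0, hre]
    calc x ^ (1 + u) * ‖F (u + T' * I)‖ * ‖kernel (u + T' * I)‖
        ≤ x ^ (1 + σ₀) * (2 * C * Real.log (T + 4) ^ 5) * (1 / T ^ 2) := by gcongr
      _ = 2 * C * Real.log (T + 4) ^ 5 * x ^ (1 + σ₀) / T ^ 2 := by ring
  have := intervalIntegral.norm_integral_le_of_norm_le_const hb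
  rwa [abs_of_nonneg (sub_nonneg.2 hσ₁₀)] at this

/-- **The left side** `Re s = σ₁` of the rectangle, kept at distance `≥ δ` from `β`
(`δ ≤ |σ₁ − β|`, `σ₁ ≥ 1/2`):
`‖∫_{−T}^{T} Φ_x(σ₁ + it) dt‖ ≤ 4π C log⁵(T+4) (1 + 1/δ) x^{1+σ₁}` (using `∫ dt/(1+t²) = π`).
[cite: MontgomeryVaughan2007, Theorem 11.16 (proof, Case 2)] -/
theorem norm_integral_left_le (h : ExcPsiData Λ F c C L β α) {x : ℝ} (hx : 1 ≤ x)
    {σ₁ T c' δ : ℝ} (hc' : 0 ≤ c') (hc'c : c' < c) (hT : 0 < T) (hσ₁ : 1 / 2 ≤ σ₁)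
    (hσ₁c : 1 - c' / (L + Real.log (T + 4)) ≤ σ₁) (hδ : 0 < δ) (hδβ : δ ≤ |σ₁ - β|) :
    ‖∫ t in (-T)..T, Phi F x (σ₁ + t * I)‖ ≤
      4 * π * C * Real.log (T + 4) ^ 5 * (1 + δ⁻¹) * x ^ (1 + σ₁) := by
  have hx0 : 0 < x := by linarith
  have hC := h.C_nonneg
  have hL := h.L_nonneg
  have hlog : 0 ≤ Real.log (T + 4) := Real.log_nonneg (by linarith)
  have hδ' : 0 ≤ 1 + δ⁻¹ := by positivity
  set M : ℝ := 4 * C * Real.log (T + 4) ^ 5 * (1 + δ⁻¹) * x ^ (1 + σ₁) with hM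
  have hM0 : 0 ≤ M := by positivity
  set g : ℝ → ℝ := fun t ↦ M * (1 + t ^ 2)⁻¹ with hg
  have hgi : Integrable g := integrable_inv_one_add_sq.const_mul M
  have hb : ∀ᵐ t : ℝ, t ∈ Ioc (-T) T → ‖Phi F x (σ₁ + t * I)‖ ≤ g t := by
    refine Eventually.of_forall fun t ht ↦ ?_
    have him : ((σ₁ : ℂ) + t * I).im = t := by simp
    have hre : ((σ₁ : ℂ) + t * I).re = σ₁ := by simp
    have htT : |t| ≤ T := abs_le.2 ⟨ht.1.le, ht.2⟩
    have hmem : ((σ₁ : ℂ) + t * I) ∈ zfrL c L :=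
      mem_zfrL_of_rect hc' hc'c hL (by rw [hre]; exact hσ₁c) (by rw [him]; exact htT)
    have hdist : δ ≤ ‖((σ₁ : ℂ) + t * I) - (β : ℂ)‖ := by
      have h1 : |(((σ₁ : ℂ) + t * I) - (β : ℂ)).re| ≤ ‖((σ₁ : ℂ) + t * I) - (β : ℂ)‖ :=
        abs_re_le_norm _
      have h2 : (((σ₁ : ℂ) + t * I) - (β : ℂ)).re = σ₁ - β := by simp
      rw [h2] at h1
      exact hδβ.trans h1
    have hF := h.norm_F_le hmem hδ hdist
    rw [him] at hF
    have hlt : Real.log (|t| + 4) ^ 5 ≤ Real.log (T + 4) ^ 5 :=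
      pow_le_pow_left₀ (ClassicalZFRData.log_tau_pos t).le
        (Real.log_le_log (by positivity) (by linarith)) 5
    have hF' : ‖F (σ₁ + t * I)‖ ≤ C * Real.log (T + 4) ^ 5 * (1 + δ⁻¹) := by
      refine hF.trans ?_
      gcongr
    have hK := norm_kernel_le_four_div hσ₁ t
    rw [norm_Phi_eq F hx0, hre, hg]
    calc x ^ (1 + σ₁) * ‖F (σ₁ + t * I)‖ * ‖kernel (σ₁ + t * I)‖
        ≤ x ^ (1 + σ₁) * (C * Real.log (T + 4) ^ 5 * (1 + δ⁻¹)) * (4 * (1 + t ^ 2)⁻¹) := by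
          gcongr
      _ = M * (1 + t ^ 2)⁻¹ := by rw [hM]; ring
  have h1 := intervalIntegral.norm_integral_le_of_norm_le (by linarith : -T ≤ T) hb
    hgi.intervalIntegrable
  refine h1.trans ?_
  rw [intervalIntegral.integral_of_le (by linarith : -T ≤ T)]
  calc ∫ t in Ioc (-T) T, g t ≤ ∫ t, g t :=
        setIntegral_le_integral hgi (Eventually.of_forall fun t ↦ by simp only [hg]; positivity)
    _ = M * π := by rw [hg, MeasureTheory.integral_const_mul, integral_univ_inv_one_add_sq]
    _ = 4 * π * C * Real.log (T + 4) ^ 5 * (1 + δ⁻¹) * x ^ (1 + σ₁) := by rw [hM]; ring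

/-! ## The estimate for the Riesz mean `ψ₁` -/

/-- Parameters of the contour for `x ≥ 3`: with `λ = √log x ≥ 1`, `T = e^λ`,
`ℓ = L + log(T + 4)`: `λ ≤ log(T+4) ≤ 3λ`, and if `L ≤ 2λ` then `λ ≤ ℓ ≤ 5λ`. [folklore] -/
theorem contour_params {x L : ℝ} (hx : 3 ≤ x) (hL : 0 ≤ L) (hLx : L ≤ 2 * Real.sqrt (Real.log x)) :
    1 ≤ Real.sqrt (Real.log x) ∧ Real.sqrt (Real.log x) ^ 2 = Real.log x ∧
    Real.sqrt (Real.log x) ≤ Real.log (Real.exp (Real.sqrt (Real.log x)) + 4) ∧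
    Real.log (Real.exp (Real.sqrt (Real.log x)) + 4) ≤ 3 * Real.sqrt (Real.log x) ∧
    Real.sqrt (Real.log x) ≤ L + Real.log (Real.exp (Real.sqrt (Real.log x)) + 4) ∧
    L + Real.log (Real.exp (Real.sqrt (Real.log x)) + 4) ≤ 5 * Real.sqrt (Real.log x) := by
  have hx0 : 0 < x := by linarith
  have hL1 : 1 ≤ Real.log x := by
    rw [← Real.log_exp 1]
    exact Real.log_le_log (Real.exp_pos 1) (by linarith [Real.exp_one_lt_d9])
  set lam : ℝ := Real.sqrt (Real.log x) with hlam
  have hlam1 : 1 ≤ lam := Real.one_le_sqrt.2 hL1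
  have hlam0 : 0 < lam := by linarith
  have hlamsq : lam ^ 2 = Real.log x := Real.sq_sqrt (by linarith)
  set T : ℝ := Real.exp lam with hT
  have hT0 : 0 < T := Real.exp_pos lam
  have hlogT : Real.log T = lam := Real.log_exp lam
  have hℓlam : lam ≤ Real.log (T + 4) := by rw [← hlogT]; exact Real.log_le_log hT0 (by linarith)
  have hℓle : Real.log (T + 4) ≤ 3 * lam := by
    have h5 : Real.log (T + 4) ≤ Real.log (Real.exp 2 * T) := by
      refine Real.log_le_log (by linarith) ?_
      have he : (5 : ℝ) ≤ Real.exp 2 := by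
        have h1 := Real.exp_one_gt_d9
        have h' : Real.exp 2 = Real.exp 1 * Real.exp 1 := by rw [← Real.exp_add]; norm_num
        rw [h']
        nlinarith
      have hT1 : 1 ≤ T := Real.one_le_exp hlam0.le
      nlinarith
    rw [Real.log_mul (Real.exp_pos 2).ne' hT0.ne', Real.log_exp, hlogT] at h5
    linarith
  exact ⟨hlam1, hlamsq, hℓlam, hℓle, by linarith, by linarith⟩

/-- The left edge saves `x^{−c/(4ℓ)} ≤ e^{−cλ/20}`: for `x ≥ 1`, `λ > 0` with `λ² = log x`,
`0 < ℓ ≤ 5λ` and `σ₁ ≤ 1 − c/(4ℓ)`, `x^{1+σ₁} ≤ x² e^{−cλ/20}`. [folklore] -/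
theorem rpow_leftEdge_le {x σ₁ c ℓ lam : ℝ} (hx : 1 ≤ x) (hlam : lam ^ 2 = Real.log x)
    (hlam0 : 0 < lam) (hc : 0 < c) (hℓ0 : 0 < ℓ) (hℓ : ℓ ≤ 5 * lam)
    (hσ₁ : σ₁ ≤ 1 - c / 4 / ℓ) :
    x ^ (1 + σ₁) ≤ x ^ 2 * Real.exp (-(c / 20 * lam)) := by
  have hx0 : 0 < x := by linarith
  have h1 : x ^ (1 + σ₁) ≤ x ^ (2 + (-(c / 4 / ℓ))) :=
    Real.rpow_le_rpow_of_exponent_le hx (by linarith)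
  refine h1.trans ?_
  rw [Real.rpow_add hx0, Real.rpow_two, Real.rpow_def_of_pos hx0, ← hlam]
  refine mul_le_mul_of_nonneg_left (Real.exp_le_exp.2 ?_) (by positivity)
  have key : c / 20 * lam ≤ lam ^ 2 * (c / 4 / ℓ) := by
    rw [div_div, mul_div_assoc', le_div_iff₀ (by positivity)]
    have := mul_le_mul_of_nonneg_left hℓ (by positivity : 0 ≤ c * lam)
    nlinarith
  linarith

/-- Size of the two tails: with `x^{1+σ₀} = e x²`, `T^{−1/2} = e^{−λ/2}`,
`1 + 1/(σ₀−1) ≤ 2λ²`, `λ ≥ 1`, `0 < c ≤ 1/2`, each tail is `≤ 3·10⁶ · Cλ⁶x²e^{−cλ/20}`.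
[folklore] -/
theorem tail_size_le {C x σ₀ T lam c : ℝ} (hC : 0 ≤ C) (hlam1 : 1 ≤ lam) (hc : 0 < c)
    (hc2 : c ≤ 1 / 2) (hxσ₀ : x ^ (1 + σ₀) = Real.exp 1 * x ^ 2)
    (hTpow : T ^ (-(1 / 2 : ℝ)) = Real.exp (-(lam / 2))) (hσinv : 1 + (σ₀ - 1)⁻¹ ≤ 2 * lam ^ 2) :
    500000 * C * (1 + (σ₀ - 1)⁻¹) * x ^ (1 + σ₀) * T ^ (-(1 / 2 : ℝ)) ≤
      3000000 * (C * lam ^ 6 * x ^ 2 * Real.exp (-(c / 20 * lam))) := by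
  have e1 : Real.exp (-(lam / 2)) ≤ Real.exp (-(c / 20 * lam)) :=
    Real.exp_le_exp.2 (by nlinarith)
  have he3 : Real.exp 1 ≤ 3 := le_of_lt (lt_trans Real.exp_one_lt_d9 (by norm_num))
  have hlam2 : lam ^ 2 ≤ lam ^ 6 := pow_le_pow_right₀ hlam1 (by norm_num)
  rw [hxσ₀, hTpow]
  calc 500000 * C * (1 + (σ₀ - 1)⁻¹) * (Real.exp 1 * x ^ 2) * Real.exp (-(lam / 2))
      ≤ 500000 * C * (2 * lam ^ 2) * (3 * x ^ 2) * Real.exp (-(c / 20 * lam)) := by gcongr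
    _ ≤ 500000 * C * (2 * lam ^ 6) * (3 * x ^ 2) * Real.exp (-(c / 20 * lam)) := by gcongr
    _ = 3000000 * (C * lam ^ 6 * x ^ 2 * Real.exp (-(c / 20 * lam))) := by ring

/-- Size of the left side: with `log(T+4)⁵ ≤ (3λ)⁵`, `1 + 1/δ ≤ 41λ/c`,
`x^{1+σ₁} ≤ x²e^{−cλ/20}`, the left side is `≤ (160000/c) · Cλ⁶x²e^{−cλ/20}` (`π ≤ 4`).
[folklore] -/
theorem left_size_le {C x σ₁ T lam c δ : ℝ} (hC : 0 ≤ C) (hlam0 : 0 ≤ lam) (hc : 0 < c)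
    (hx0 : 0 < x) (hℓT5 : Real.log (T + 4) ^ 5 ≤ (3 * lam) ^ 5) (hlog0 : 0 ≤ Real.log (T + 4))
    (hδinv : 1 + δ⁻¹ ≤ 41 * lam / c) (hδpos : 0 ≤ 1 + δ⁻¹)
    (hxσ₁ : x ^ (1 + σ₁) ≤ x ^ 2 * Real.exp (-(c / 20 * lam))) :
    4 * π * C * Real.log (T + 4) ^ 5 * (1 + δ⁻¹) * x ^ (1 + σ₁) ≤
      160000 / c * (C * lam ^ 6 * x ^ 2 * Real.exp (-(c / 20 * lam))) := by
  have hπ : π ≤ 4 := Real.pi_le_four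
  have hE0 : 0 ≤ C * lam ^ 6 * x ^ 2 * Real.exp (-(c / 20 * lam)) := by positivity
  have hxσ₁0 : 0 ≤ x ^ (1 + σ₁) := by positivity
  calc 4 * π * C * Real.log (T + 4) ^ 5 * (1 + δ⁻¹) * x ^ (1 + σ₁)
      ≤ 4 * 4 * C * (3 * lam) ^ 5 * (41 * lam / c) * (x ^ 2 * Real.exp (-(c / 20 * lam))) := by
        gcongr
    _ = (4 * 4 * 243 * 41) / c * (C * lam ^ 6 * x ^ 2 * Real.exp (-(c / 20 * lam))) := by
        field_simp
        ring
    _ ≤ 160000 / c * (C * lam ^ 6 * x ^ 2 * Real.exp (-(c / 20 * lam))) :=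
        mul_le_mul_of_nonneg_right (div_le_div_of_nonneg_right (by norm_num) hc.le) hE0

/-- Size of the horizontal sides: with `x^{1+σ₀} = e x²`, `1/T² = e^{−2λ}`,
`log(T+4)⁵ ≤ (3λ)⁵`, `σ₀ − σ₁ ≤ 2`, `λ ≥ 1`, each is `≤ 3000 · Cλ⁶x²e^{−cλ/20}`. [folklore] -/
theorem horizontal_size_le {C x σ₀ σ₁ T lam c : ℝ} (hC : 0 ≤ C) (hlam1 : 1 ≤ lam) (hc : 0 < c)
    (hc2 : c ≤ 1 / 2) (hx0 : 0 < x) (hxσ₀ : x ^ (1 + σ₀) = Real.exp 1 * x ^ 2)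
    (hT2 : 1 / T ^ 2 = Real.exp (-(2 * lam))) (hℓT5 : Real.log (T + 4) ^ 5 ≤ (3 * lam) ^ 5)
    (hdiff : σ₀ - σ₁ ≤ 2) (hdiff0 : 0 ≤ σ₀ - σ₁) :
    2 * C * Real.log (T + 4) ^ 5 * x ^ (1 + σ₀) / T ^ 2 * (σ₀ - σ₁) ≤
      3000 * (C * lam ^ 6 * x ^ 2 * Real.exp (-(c / 20 * lam))) := by
  have e2 : Real.exp (-(2 * lam)) ≤ Real.exp (-(c / 20 * lam)) :=
    Real.exp_le_exp.2 (by nlinarith)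
  have he3 : Real.exp 1 ≤ 3 := le_of_lt (lt_trans Real.exp_one_lt_d9 (by norm_num))
  have hlam5 : lam ^ 5 ≤ lam ^ 6 := pow_le_pow_right₀ hlam1 (by norm_num)
  have hE0 : 0 ≤ C * lam ^ 6 * x ^ 2 * Real.exp (-(c / 20 * lam)) := by positivity
  rw [hxσ₀, div_eq_mul_one_div _ (T ^ 2), hT2]
  calc 2 * C * Real.log (T + 4) ^ 5 * (Real.exp 1 * x ^ 2) * Real.exp (-(2 * lam)) * (σ₀ - σ₁)
      ≤ 2 * C * (3 * lam) ^ 5 * (3 * x ^ 2) * Real.exp (-(c / 20 * lam)) * 2 := by gcongr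
    _ = 2916 * (C * lam ^ 5 * x ^ 2 * Real.exp (-(c / 20 * lam))) := by ring
    _ ≤ 2916 * (C * lam ^ 6 * x ^ 2 * Real.exp (-(c / 20 * lam))) := by gcongr
    _ ≤ 3000 * (C * lam ^ 6 * x ^ 2 * Real.exp (-(c / 20 * lam))) := by nlinarith

/-- The sum of the five sizes: `2·3000000E + (160000/c)E + 2·3000E ≤ (3200000/c)E` for
`0 < c ≤ 1/2`, `E ≥ 0`. [folklore] -/
theorem five_sizes_le {c E : ℝ} (hc : 0 < c) (hc2 : c ≤ 1 / 2) (hE : 0 ≤ E) :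
    3000000 * E + 3000000 * E + 160000 / c * E + 3000 * E + 3000 * E ≤ 3200000 / c * E := by
  have h6 : (6006000 : ℝ) * E ≤ 3040000 / c * E := by
    refine mul_le_mul_of_nonneg_right ?_ hE
    rw [le_div_iff₀ hc]; nlinarith
  have h7 : 3040000 / c * E + 160000 / c * E = 3200000 / c * E := by ring
  linarith

/-- **Landau's estimate for the Riesz mean with an exceptional zero, for a given admissible left
edge.** Under `ExcPsiData Λ F c C L β α`, for `x ≥ 3` with `L ≤ 2√log x`, put `λ = √log x`,
`T = e^λ`, `ℓ = L + log(T+4)`; if `1 − c/(2ℓ) ≤ σ₁ ≤ 1 − c/(4ℓ)` and `|σ₁ − β| ≥ c/(8ℓ)` then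
`|ψ₁(x) − (x−1)²/2 + αM_β(x)| ≤ (3200000/c) C λ⁶ x² e^{−cλ/20}`.
(`σ₀ = 1 + 1/log x`; the five pieces of `integral_line_eq`.)
[cite: MontgomeryVaughan2007, Theorem 11.16 (proof, Case 2)] -/
theorem abs_rieszMean_sub_le_of_left (h : ExcPsiData Λ F c C L β α) {x : ℝ} (hx : 3 ≤ x)
    (hLx : L ≤ 2 * Real.sqrt (Real.log x)) {σ₁ : ℝ}
    (hσ₁lo : 1 - c / 2 / (L + Real.log (Real.exp (Real.sqrt (Real.log x)) + 4)) ≤ σ₁)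
    (hσ₁hi : σ₁ ≤ 1 - c / 4 / (L + Real.log (Real.exp (Real.sqrt (Real.log x)) + 4)))
    (hσ₁β : c / 8 / (L + Real.log (Real.exp (Real.sqrt (Real.log x)) + 4)) ≤ |σ₁ - β|) :
    |(∑ n ∈ Finset.Ioc 0 ⌊x⌋₊, Λ n * (x - n)) - (x - 1) ^ 2 / 2 + α * betaMain β x| ≤
      3200000 / c * C * Real.sqrt (Real.log x) ^ 6 * x ^ 2 *
        Real.exp (-(c / 20 * Real.sqrt (Real.log x))) := by
  have hc := h.c_pos
  have hc2 := h.c_le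
  have hC := h.C_nonneg
  have hL := h.L_nonneg
  obtain ⟨hlam1, hlamsq, -, hℓle, hℓlo, hℓhi⟩ := contour_params hx hL hLx
  -- parameters
  have hx1 : 1 ≤ x := by linarith
  have hx0 : 0 < x := by linarith
  set lam : ℝ := Real.sqrt (Real.log x) with hlam
  have hlam0 : 0 < lam := by linarith
  set lx : ℝ := Real.log x with hlx
  have hlx0 : 0 < lx := by rw [← hlamsq]; positivity
  have hlx1 : 1 ≤ lx := by rw [← hlamsq]; exact one_le_pow₀ hlam1
  set T : ℝ := Real.exp lam with hT
  have hT1 : 1 ≤ T := Real.one_le_exp hlam0.le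
  have hT0 : 0 < T := by linarith
  set ℓ : ℝ := L + Real.log (T + 4) with hℓ
  have hℓ1 : 1 ≤ ℓ := hlam1.trans hℓlo
  have hℓ0 : 0 < ℓ := by linarith
  have hlog0 : 0 ≤ Real.log (T + 4) := Real.log_nonneg (by linarith)
  set σ₀ : ℝ := 1 + 1 / lx with hσ₀
  have hσ₀1 : 1 < σ₀ := by
    have : 0 < 1 / lx := by positivity
    rw [hσ₀]; linarith
  have hσ₀2 : σ₀ ≤ 2 := by rw [hσ₀]; have := (div_le_one hlx0).2 hlx1; linarith
  set c' : ℝ := c / 2 with hc'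
  have hc'0 : 0 ≤ c' := by positivity
  have hc'c : c' < c := by rw [hc']; linarith
  -- the left edge
  have hcℓ : c / 2 / ℓ ≤ 1 / 4 := by
    rw [div_le_iff₀ hℓ0]; linarith
  have hc4ℓ : 0 < c / 4 / ℓ := by positivity
  have hσ₁34 : 3 / 4 ≤ σ₁ := by linarith
  have hσ₁0 : 0 < σ₁ := by linarith
  have hσ₁₀ : σ₁ ≤ σ₀ := by linarith
  have hσ₁c : 1 - c' / (L + Real.log (T + 4)) ≤ σ₁ := by rw [hc']; exact hσ₁lo
  set δ : ℝ := c / 8 / ℓ with hδdef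
  have hδ : 0 < δ := by positivity
  have hδpos : 0 ≤ 1 + δ⁻¹ := by positivity
  -- powers of `x` and `T`
  have hxσ₀ : x ^ (1 + σ₀) = Real.exp 1 * x ^ 2 := by
    rw [hσ₀, show (1 : ℝ) + (1 + 1 / lx) = 2 + 1 / lx by ring, Real.rpow_add hx0, Real.rpow_two,
      Real.rpow_def_of_pos hx0, ← hlx, mul_one_div_cancel hlx0.ne', mul_comm]
  have hxσ₁ : x ^ (1 + σ₁) ≤ x ^ 2 * Real.exp (-(c / 20 * lam)) :=
    rpow_leftEdge_le hx1 hlamsq hlam0 hc hℓ0 hℓhi hσ₁hi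
  have hTpow : T ^ (-(1 / 2 : ℝ)) = Real.exp (-(lam / 2)) := by
    rw [hT, ← Real.exp_mul]; congr 1; ring
  have hT2 : 1 / T ^ 2 = Real.exp (-(2 * lam)) := by
    rw [hT, sq, ← Real.exp_add, Real.exp_neg, one_div]; congr 1; ring_nf
  have hσinv : 1 + (σ₀ - 1)⁻¹ ≤ 2 * lam ^ 2 := by
    have : (σ₀ - 1)⁻¹ = lx := by rw [hσ₀]; field_simp; ring
    rw [this, ← hlamsq]
    have : 1 ≤ lam ^ 2 := one_le_pow₀ hlam1
    linarith
  have hℓT5 : Real.log (T + 4) ^ 5 ≤ (3 * lam) ^ 5 := pow_le_pow_left₀ hlog0 hℓle 5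
  have hδinv : 1 + δ⁻¹ ≤ 41 * lam / c := by
    have h1 : δ⁻¹ = 8 * ℓ / c := by rw [hδdef]; field_simp
    rw [h1]
    have h2 : 8 * ℓ / c ≤ 40 * lam / c := div_le_div_of_nonneg_right (by linarith) hc.le
    have h3 : (1 : ℝ) ≤ lam / c := by
      rw [le_div_iff₀ hc]; linarith
    have h4 : 41 * lam / c = 40 * lam / c + lam / c := by ring
    linarith
  -- Perron, Cauchy, and the five bounds
  have hint := h.integrable_Phi hx0 hσ₀1
  have hA := h.rieszMean_sub_mainTerms_eq hx1 hσ₀1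
  have hsplit := h.integral_line_eq hx0 hc'0 hc'c hT0 hσ₁0 hσ₁₀ hσ₁c hint
  have b1 := h.norm_integral_Iic_le hx1 hσ₀1 hT1
  have b2 := h.norm_integral_Ioi_le hx1 hσ₀1 hT1
  have b3 := h.norm_integral_left_le hx1 hc'0 hc'c hT0 (by linarith : 1 / 2 ≤ σ₁) hσ₁c hδ hσ₁β
  have b4 := h.norm_integral_horizontal_le hx1 hc'0 hc'c hT1 hσ₁₀ hσ₁c (T' := -T)
    (by rw [abs_neg, abs_of_pos hT0])
  have b5 := h.norm_integral_horizontal_le hx1 hc'0 hc'c hT1 hσ₁₀ hσ₁c (T' := T) (abs_of_pos hT0)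
  simp only [ofReal_neg, neg_mul] at b4 hsplit
  -- sizes of the pieces
  set E : ℝ := C * lam ^ 6 * x ^ 2 * Real.exp (-(c / 20 * lam)) with hE
  have hE0 : 0 ≤ E := by positivity
  have s12 := tail_size_le hC hlam1 hc hc2 hxσ₀ hTpow hσinv
  have s3 := left_size_le hC hlam0.le hc hx0 hℓT5 hlog0 hδinv hδpos hxσ₁
  have s45 := horizontal_size_le hC hlam1 hc hc2 hx0 hxσ₀ hT2 hℓT5
    (by linarith : σ₀ - σ₁ ≤ 2) (by linarith : 0 ≤ σ₀ - σ₁)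
  rw [← hE] at s12 s3 s45
  -- the norm of the line integral
  have hI : ∀ z : ℂ, ‖I * z‖ = ‖z‖ := fun z ↦ by rw [norm_mul, norm_I, one_mul]
  have hline : ‖∫ t : ℝ, Phi F x (σ₀ + t * I)‖ ≤ 3200000 / c * E := by
    rw [hsplit]
    refine (norm_add_add_add_sub_le _ _ _ _ _).trans ?_
    rw [hI, hI]
    have := add_le_add (add_le_add (add_le_add (add_le_add (b1.trans s12) (b2.trans s12))
      (b3.trans s3)) (b4.trans s45)) (b5.trans s45)
    exact this.trans (five_sizes_le hc hc2 hE0)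
  -- conclusion
  have hreal : (((∑ n ∈ Finset.Ioc 0 ⌊x⌋₊, Λ n * (x - n)) - (x - 1) ^ 2 / 2 +
      α * betaMain β x : ℝ) : ℂ) = (1 / (2 * π) : ℂ) * ∫ t : ℝ, Phi F x (σ₀ + t * I) := by
    rw [← hA]; push_cast; ring
  rw [← Real.norm_eq_abs, ← Complex.norm_real, hreal, norm_mul]
  have h2π : ‖(1 / (2 * π) : ℂ)‖ ≤ 1 := by
    rw [show (1 / (2 * π) : ℂ) = ((1 / (2 * π) : ℝ) : ℂ) by push_cast; ring, Complex.norm_real,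
      Real.norm_eq_abs, abs_of_pos (by positivity)]
    rw [div_le_one (by positivity)]
    linarith [Real.two_le_pi]
  have hfin0 : 0 ≤ 3200000 / c * E := by positivity
  calc ‖(1 / (2 * π) : ℂ)‖ * ‖∫ t : ℝ, Phi F x (σ₀ + t * I)‖
      ≤ 1 * (3200000 / c * E) := by gcongr
    _ = 3200000 / c * C * lam ^ 6 * x ^ 2 * Real.exp (-(c / 20 * lam)) := by rw [hE]; ring

/-- **Landau's estimate for the Riesz mean with an exceptional zero** (MV Theorem 11.16, Case 2,
for `ψ₁`): for every `0 < c ≤ 1/2` there is `A = A(c)` such that under `ExcPsiData Λ F c C L β α`,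
for all `x ≥ 3` with `L ≤ 2√log x`,
`|ψ₁(x) − (x−1)²/2 + α(x^{1+β}/(β(1+β)) − x/β + 1/(1+β))| ≤ A C x² exp(−(c/40)√log x)`.
The left edge of the rectangle is `1 − c/(2ℓ)` or `1 − c/(4ℓ)`, whichever is at distance
`≥ c/(8ℓ)` from `β` (`ℓ = L + log(e^{√log x} + 4)`); `λ⁶e^{−cλ/40} ≤ 720(40/c)⁶`.
[cite: MontgomeryVaughan2007, Theorem 11.16] -/
theorem exists_rieszMean_bound {c : ℝ} (hc : 0 < c) (hc2 : c ≤ 1 / 2) :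
    ∃ A : ℝ, 0 < A ∧ ∀ {Λ : ℕ → ℝ} {F : ℂ → ℂ} {C L β α : ℝ}, ExcPsiData Λ F c C L β α →
      ∀ x : ℝ, 3 ≤ x → L ≤ 2 * Real.sqrt (Real.log x) →
        |(∑ n ∈ Finset.Ioc 0 ⌊x⌋₊, Λ n * (x - n)) - (x - 1) ^ 2 / 2 + α * betaMain β x| ≤
          A * C * x ^ 2 * Real.exp (-(c / 40 * Real.sqrt (Real.log x))) := by
  have _ := hc2
  refine ⟨3200000 / c * ((Nat.factorial 6 : ℝ) / (c / 40) ^ 6), by positivity,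
    fun {Λ F C L β α} h x hx hLx ↦ ?_⟩
  have hC := h.C_nonneg
  have hL := h.L_nonneg
  obtain ⟨hlam1, -, -, -, hℓlo, -⟩ := contour_params hx hL hLx
  set lam : ℝ := Real.sqrt (Real.log x) with hlam
  set ℓ : ℝ := L + Real.log (Real.exp lam + 4) with hℓ
  have hℓ0 : 0 < ℓ := by linarith
  -- choose the left edge
  set σa : ℝ := 1 - c / 2 / ℓ with hσa
  set σb : ℝ := 1 - c / 4 / ℓ with hσb
  have hab : σa ≤ σb := by
    rw [hσa, hσb]
    have : c / 4 / ℓ ≤ c / 2 / ℓ := div_le_div_of_nonneg_right (by linarith) hℓ0.le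
    linarith
  have hgap : σb - σa = 2 * (c / 8 / ℓ) := by rw [hσa, hσb]; ring
  obtain ⟨σ₁, hlo, hhi, hdist⟩ : ∃ σ₁ : ℝ, σa ≤ σ₁ ∧ σ₁ ≤ σb ∧ c / 8 / ℓ ≤ |σ₁ - β| := by
    rcases le_or_gt (c / 8 / ℓ) |σa - β| with h1 | h1
    · exact ⟨σa, le_rfl, hab, h1⟩
    · refine ⟨σb, hab, le_rfl, ?_⟩
      have htri : |σb - σa| ≤ |σb - β| + |σa - β| := by
        have := abs_sub_le σb β σa
        rwa [abs_sub_comm β σa] at this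
      rw [hgap, abs_of_pos (by positivity)] at htri
      linarith
  have hmain := h.abs_rieszMean_sub_le_of_left hx hLx hlo hhi hdist
  refine hmain.trans ?_
  -- absorb `λ⁶ e^{-cλ/40}`
  have hsplit : Real.exp (-(c / 20 * lam)) = Real.exp (-(c / 40 * lam)) * Real.exp (-(c / 40 * lam)) := by
    rw [← Real.exp_add]; ring_nf
  have hpow : lam ^ 6 * Real.exp (-(c / 40 * lam)) ≤ (Nat.factorial 6 : ℝ) / (c / 40) ^ 6 := by
    have h := Real.pow_div_factorial_le_exp (c / 40 * lam) (by positivity) 6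
    rw [mul_pow, div_le_iff₀ (by positivity)] at h
    rw [Real.exp_neg, le_div_iff₀ (by positivity)]
    have hE := Real.exp_pos (c / 40 * lam)
    calc lam ^ 6 * (Real.exp (c / 40 * lam))⁻¹ * (c / 40) ^ 6
        = ((c / 40) ^ 6 * lam ^ 6) / Real.exp (c / 40 * lam) := by field_simp
      _ ≤ (Nat.factorial 6 : ℝ) := by rw [div_le_iff₀ hE]; linarith
  calc 3200000 / c * C * lam ^ 6 * x ^ 2 * Real.exp (-(c / 20 * lam))
      = 3200000 / c * (lam ^ 6 * Real.exp (-(c / 40 * lam))) * C * x ^ 2 *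
          Real.exp (-(c / 40 * lam)) := by rw [hsplit]; ring
    _ ≤ 3200000 / c * ((Nat.factorial 6 : ℝ) / (c / 40) ^ 6) * C * x ^ 2 *
          Real.exp (-(c / 40 * lam)) := by gcongr

/-! ## From `ψ₁` to `ψ`: differencing (Landau 1903 §8) -/

/-- **Tangent line below a convex power**: for `a, b > 0` and `p ≥ 1`,
`a^p + p a^{p−1}(b − a) ≤ b^p` (Bernoulli's inequality `1 + ps ≤ (1+s)^p` at `s = b/a − 1`).
[folklore] -/
theorem rpow_add_mul_sub_le_rpow {a b p : ℝ} (ha : 0 < a) (hb : 0 < b) (hp : 1 ≤ p) :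
    a ^ p + p * a ^ (p - 1) * (b - a) ≤ b ^ p := by
  have ha' : a ≠ 0 := ha.ne'
  set s : ℝ := b / a - 1 with hs
  have hs1 : -1 ≤ s := by rw [hs]; have : 0 < b / a := div_pos hb ha; linarith
  have hB := one_add_mul_self_le_rpow_one_add hs1 hp
  have h1s : 1 + s = b / a := by rw [hs]; ring
  rw [h1s, Real.div_rpow hb.le ha.le] at hB
  have hap : 0 < a ^ p := Real.rpow_pos_of_pos ha p
  have hq : a ^ p * (b ^ p / a ^ p) = b ^ p := by field_simp
  have key : a ^ p * (1 + p * s) ≤ b ^ p := by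
    calc a ^ p * (1 + p * s) ≤ a ^ p * (b ^ p / a ^ p) := mul_le_mul_of_nonneg_left hB hap.le
      _ = b ^ p := hq
  have hexp : a ^ p * (1 + p * s) = a ^ p + p * a ^ (p - 1) * (b - a) := by
    rw [hs, Real.rpow_sub_one ha' p]; field_simp
  linarith

/-- **Chord above a concave power**: for `1 ≤ a ≤ b` and `0 ≤ p ≤ 1`, `b^p − a^p ≤ b − a`
(Bernoulli's inequality `(1+s)^p ≤ 1 + ps`, and `p a^{p−1} ≤ 1`). [folklore] -/
theorem rpow_sub_rpow_le_sub {a b p : ℝ} (ha : 1 ≤ a) (hab : a ≤ b) (hp0 : 0 ≤ p) (hp1 : p ≤ 1) :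
    b ^ p - a ^ p ≤ b - a := by
  have ha0 : 0 < a := by linarith
  have hb0 : 0 < b := by linarith
  have ha' : a ≠ 0 := ha0.ne'
  set s : ℝ := b / a - 1 with hs
  have hs0 : 0 ≤ s := by
    rw [hs, sub_nonneg, le_div_iff₀ ha0, one_mul]; exact hab
  have hB := rpow_one_add_le_one_add_mul_self (by linarith : -1 ≤ s) hp0 hp1
  have h1s : 1 + s = b / a := by rw [hs]; ring
  rw [h1s, Real.div_rpow hb0.le ha0.le] at hB
  have hap : 0 < a ^ p := Real.rpow_pos_of_pos ha0 p
  have hq : a ^ p * (b ^ p / a ^ p) = b ^ p := by field_simp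
  have key : b ^ p ≤ a ^ p * (1 + p * s) := by
    calc b ^ p = a ^ p * (b ^ p / a ^ p) := hq.symm
      _ ≤ a ^ p * (1 + p * s) := mul_le_mul_of_nonneg_left hB hap.le
  have hexp : a ^ p * (1 + p * s) = a ^ p + p * a ^ (p - 1) * (b - a) := by
    rw [hs, Real.rpow_sub_one ha' p]; field_simp
  have hsmall : p * a ^ (p - 1) ≤ 1 := by
    have h1 : a ^ (p - 1) ≤ 1 := Real.rpow_le_one_of_one_le_of_nonpos ha (by linarith)
    have h2 : 0 ≤ a ^ (p - 1) := (Real.rpow_pos_of_pos ha0 _).le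
    nlinarith
  have hba : 0 ≤ b - a := by linarith
  have : p * a ^ (p - 1) * (b - a) ≤ 1 * (b - a) := mul_le_mul_of_nonneg_right hsmall hba
  linarith

/-- **Taylor remainder of `u^{1+β}/(1+β)`**: for `x, y ≥ 1` and `0 < β ≤ 1`,
`0 ≤ (y^{1+β} − x^{1+β})/(1+β) − (y − x)x^β ≤ (y − x)²` (two tangent lines and a chord).
[folklore] -/
theorem abs_betaRemainder_le {x y β : ℝ} (hx : 1 ≤ x) (hy : 1 ≤ y) (hβ0 : 0 < β) (hβ1 : β ≤ 1) :
    |(y ^ (1 + β) - x ^ (1 + β)) / (1 + β) - (y - x) * x ^ β| ≤ (y - x) ^ 2 := by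
  have hx0 : 0 < x := by linarith
  have hy0 : 0 < y := by linarith
  have hp : (1:ℝ) ≤ 1 + β := by linarith
  have h1 := rpow_add_mul_sub_le_rpow hx0 hy0 hp
  have h2 := rpow_add_mul_sub_le_rpow hy0 hx0 hp
  rw [show (1 + β) - 1 = β by ring] at h1 h2
  have h1β : (0:ℝ) < 1 + β := by linarith
  set R := (y ^ (1 + β) - x ^ (1 + β)) / (1 + β) - (y - x) * x ^ β with hR
  have hRlo : 0 ≤ R := by
    rw [hR, sub_nonneg, le_div_iff₀ h1β]; nlinarith [h1]
  have hRhi : R ≤ (y - x) * (y ^ β - x ^ β) := by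
    rw [hR, sub_le_iff_le_add, div_le_iff₀ h1β]; nlinarith [h2]
  have hprod : (y - x) * (y ^ β - x ^ β) ≤ (y - x) ^ 2 := by
    rcases le_total x y with hxy | hxy
    · have := rpow_sub_rpow_le_sub hx hxy hβ0.le hβ1
      have hyx : 0 ≤ y - x := by linarith
      nlinarith
    · have := rpow_sub_rpow_le_sub hy hxy hβ0.le hβ1
      have hyx : 0 ≤ x - y := by linarith
      nlinarith
  rw [abs_of_nonneg hRlo]
  linarith

/-- The main term of `ψ₁`: `M₁(y) = (y − 1)²/2 − α M_β(y)`. [cite: MontgomeryVaughan2007, Theorem 11.16] -/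
def excMain₁ (β α y : ℝ) : ℝ := (y - 1) ^ 2 / 2 - α * betaMain β y

/-- The main term of `ψ`: `M(y) = M₁'(y) = (y − 1) − α(y^β − 1)/β`. [cite: MontgomeryVaughan2007, Theorem 11.16] -/
def excMain (β α y : ℝ) : ℝ := (y - 1) - α * (y ^ β - 1) / β

/-- **Taylor's formula for `M₁`** with `M₁'' = 1 − αu^{β−1} ∈ [0, 2]`: for `x, y ≥ 1`,
`1/2 ≤ β ≤ 1`, `|α| ≤ 1`,
`|M₁(y) − M₁(x) − (y − x)M(x) − (y − x)²/2| ≤ 2(y − x)²`. [folklore] -/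
theorem excMain₁_taylor {β α x y : ℝ} (hβ : 1 / 2 ≤ β) (hβ1 : β ≤ 1) (hα : |α| ≤ 1)
    (hx : 1 ≤ x) (hy : 1 ≤ y) :
    |excMain₁ β α y - excMain₁ β α x - (y - x) * excMain β α x - (y - x) ^ 2 / 2| ≤
      2 * (y - x) ^ 2 := by
  have hβ0 : 0 < β := by linarith
  have hβ0' : β ≠ 0 := hβ0.ne'
  have h1β : (1 + β : ℝ) ≠ 0 := by linarith
  have hRle := abs_betaRemainder_le hx hy hβ0 hβ1
  have hid : excMain₁ β α y - excMain₁ β α x - (y - x) * excMain β α x - (y - x) ^ 2 / 2 =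
      -(α / β) * ((y ^ (1 + β) - x ^ (1 + β)) / (1 + β) - (y - x) * x ^ β) := by
    simp only [excMain₁, excMain, betaMain]
    field_simp
    ring
  rw [hid, abs_mul, abs_neg, abs_div, abs_of_pos hβ0]
  have h1 : |α| / β ≤ 2 := by rw [div_le_iff₀ hβ0]; linarith
  exact mul_le_mul h1 hRle (abs_nonneg _) (by norm_num)

/-- Upper differencing step (arithmetic): from `hψ ≤ ψ₁(x+h) − ψ₁(x)`, the two `ψ₁`-errors `≤ E`
and Taylor, `ψ − M ≤ (5/2)h + 2E/h`. [cite: LandauMathAnn1903, §8] -/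
theorem diff_upper {P R₁ R₀ M₁y M₁x Mx E hh : ℝ} (hh0 : 0 < hh) (hd : hh * P ≤ R₁ - R₀)
    (he1 : |R₁ - M₁y| ≤ E) (he0 : |R₀ - M₁x| ≤ E)
    (ht : |M₁y - M₁x - hh * Mx - hh ^ 2 / 2| ≤ 2 * hh ^ 2) :
    P - Mx ≤ 5 / 2 * hh + 2 * E / hh := by
  have a1 := (abs_le.1 he1).2
  have a2 := (abs_le.1 he0).1
  have a3 := (abs_le.1 ht).2
  have key : hh * (P - Mx) ≤ hh * (5 / 2 * hh + 2 * E / hh) := by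
    have : hh * (5 / 2 * hh + 2 * E / hh) = 5 / 2 * hh ^ 2 + 2 * E := by field_simp
    rw [this]
    nlinarith
  exact le_of_mul_le_mul_left key hh0

/-- Lower differencing step (arithmetic): from `ψ₁(x) − ψ₁(x−h) ≤ hψ`, the two `ψ₁`-errors
`≤ E` and Taylor, `−(5/2)h − 2E/h ≤ ψ − M`. [cite: LandauMathAnn1903, §8] -/
theorem diff_lower {P R₁ R₀ M₁y M₁x Mx E hh : ℝ} (hh0 : 0 < hh) (hd : R₀ - R₁ ≤ hh * P)
    (he1 : |R₁ - M₁y| ≤ E) (he0 : |R₀ - M₁x| ≤ E)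
    (ht : |M₁y - M₁x - (-hh) * Mx - (-hh) ^ 2 / 2| ≤ 2 * (-hh) ^ 2) :
    -(5 / 2 * hh + 2 * E / hh) ≤ P - Mx := by
  have a1 := (abs_le.1 he1).2
  have a2 := (abs_le.1 he0).1
  have a3 := (abs_le.1 ht).2
  have key : hh * (-(5 / 2 * hh + 2 * E / hh)) ≤ hh * (P - Mx) := by
    have : hh * (-(5 / 2 * hh + 2 * E / hh)) = -(5 / 2 * hh ^ 2 + 2 * E) := by field_simp
    rw [this]
    nlinarith
  exact le_of_mul_le_mul_left key hh0

/-- `log 64 ≥ 4`. [folklore] -/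
theorem four_le_log_64 : (4 : ℝ) ≤ Real.log 64 := by
  rw [Real.le_log_iff_exp_le (by norm_num)]
  have h1 := Real.exp_one_lt_d9
  have h0 := (Real.exp_pos 1).le
  have : Real.exp 4 = (Real.exp 1) ^ 4 := by rw [← Real.exp_nat_mul]; norm_num
  rw [this]
  calc Real.exp 1 ^ 4 ≤ (2.7182818286 : ℝ) ^ 4 := by gcongr
    _ ≤ 64 := by norm_num

/-- Parameters of the differencing for `x ≥ 64`, `y ≥ x/2`: `λ = √log x ≥ 2`, `y ≥ 3`,
`√log y ≥ λ − 1 ≥ λ/2`. [folklore] -/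
theorem diff_params {x y : ℝ} (hx : 64 ≤ x) (hy : x / 2 ≤ y) :
    2 ≤ Real.sqrt (Real.log x) ∧ 3 ≤ y ∧
    Real.sqrt (Real.log x) - 1 ≤ Real.sqrt (Real.log y) ∧
    Real.sqrt (Real.log x) ≤ 2 * Real.sqrt (Real.log y) := by
  have hlog : 4 ≤ Real.log x := four_le_log_64.trans (Real.log_le_log (by norm_num) hx)
  have h4 : Real.sqrt 4 = 2 := by
    rw [show (4:ℝ) = 2 ^ 2 by norm_num, Real.sqrt_sq (by norm_num)]
  have hlam2 : 2 ≤ Real.sqrt (Real.log x) := by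
    rw [← h4]
    exact Real.sqrt_le_sqrt hlog
  have hs := sqrt_log_sub_one_le (by linarith : (6:ℝ) ≤ x) hy
  exact ⟨hlam2, by linarith, hs, by linarith⟩

/-- The `ψ₁`-error at a nearby point: if `|ψ₁(y) − M₁(y)| ≤ A C y² e^{−κ√log y}` with
`x/2 ≤ y ≤ 3x/2`, `√log y ≥ √log x − 1`, `0 ≤ κ ≤ 1/80`, then it is `≤ 5 A C x² e^{−κ√log x}`.
[folklore] -/
theorem err_nearby_le {A C x y κ Ey : ℝ} (hA : 0 ≤ A) (hC : 0 ≤ C) (hx0 : 0 < x)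
    (hy1 : x / 2 ≤ y) (hy2 : y ≤ 3 * x / 2) (hs : Real.sqrt (Real.log x) - 1 ≤ Real.sqrt (Real.log y))
    (hκ0 : 0 ≤ κ) (hκ1 : κ ≤ 1 / 80)
    (hE : Ey ≤ A * C * y ^ 2 * Real.exp (-(κ * Real.sqrt (Real.log y)))) :
    Ey ≤ 5 * A * C * x ^ 2 * Real.exp (-(κ * Real.sqrt (Real.log x))) := by
  have hy0 : 0 < y := by linarith
  have hysq : y ^ 2 ≤ 9 / 4 * x ^ 2 := by nlinarith
  have hexp : Real.exp (-(κ * Real.sqrt (Real.log y))) ≤ 2 * Real.exp (-(κ * Real.sqrt (Real.log x))) := by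
    have h1 : -(κ * Real.sqrt (Real.log y)) ≤ κ + -(κ * Real.sqrt (Real.log x)) := by
      have := mul_le_mul_of_nonneg_left hs hκ0
      linarith
    have h2 : Real.exp κ ≤ 2 := by
      have hl := Real.add_one_le_exp (-κ)
      have hk : 79 / 80 ≤ Real.exp (-κ) := by linarith
      have hprod : Real.exp κ * Real.exp (-κ) = 1 := by rw [← Real.exp_add]; simp
      have hpos := Real.exp_pos κ
      nlinarith
    calc Real.exp (-(κ * Real.sqrt (Real.log y))) ≤ Real.exp (κ + -(κ * Real.sqrt (Real.log x))) :=
          Real.exp_le_exp.2 h1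
      _ = Real.exp κ * Real.exp (-(κ * Real.sqrt (Real.log x))) := Real.exp_add _ _
      _ ≤ 2 * Real.exp (-(κ * Real.sqrt (Real.log x))) := by gcongr
  refine hE.trans ?_
  have hAC : 0 ≤ A * C := mul_nonneg hA hC
  calc A * C * y ^ 2 * Real.exp (-(κ * Real.sqrt (Real.log y)))
      ≤ A * C * (9 / 4 * x ^ 2) * (2 * Real.exp (-(κ * Real.sqrt (Real.log x)))) := by gcongr
    _ = 9 / 2 * A * C * x ^ 2 * Real.exp (-(κ * Real.sqrt (Real.log x))) := by ring
    _ ≤ 5 * A * C * x ^ 2 * Real.exp (-(κ * Real.sqrt (Real.log x))) := by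
        have : 0 ≤ A * C * x ^ 2 * Real.exp (-(κ * Real.sqrt (Real.log x))) := by positivity
        nlinarith

/-- Sizes in the differencing: with `h = xu/2`, `E = 5ACx²u²`,
`(5/2)h + 2E/h = (5/4 + 20AC)·xu`. [folklore] -/
theorem diff_sizes_eq {A C x u : ℝ} (hx : 0 < x) (hu : 0 < u) :
    5 / 2 * (x * u / 2) + 2 * (5 * A * C * x ^ 2 * (u * u)) / (x * u / 2) =
      (5 / 4 + 20 * A * C) * (x * u) := by
  field_simp
  ring

/-- The recentring constant: `|M(x) − (x − αx^β/β)| = |α/β − 1| ≤ 3` for `β ≥ 1/2`, `|α| ≤ 1`.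
[folklore] -/
theorem abs_excMain_sub_le {β α x : ℝ} (hβ : 1 / 2 ≤ β) (hα : |α| ≤ 1) :
    |excMain β α x - (x - α * x ^ β / β)| ≤ 3 := by
  have hβ0 : 0 < β := by linarith
  have : excMain β α x - (x - α * x ^ β / β) = α / β - 1 := by
    simp only [excMain]; field_simp; ring
  rw [this]
  have h1 : |α / β| ≤ 2 := by
    rw [abs_div, abs_of_pos hβ0, div_le_iff₀ hβ0]; linarith
  calc |α / β - 1| ≤ |α / β| + |(1:ℝ)| := abs_sub _ _
    _ ≤ 3 := by rw [abs_one]; linarith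

/-- `1 ≤ x e^{−(c/80)√log x}` for `x ≥ 64` (indeed `x ≥ e`) and `0 < c ≤ 1/2`. [folklore] -/
theorem one_le_mul_exp_neg {x c : ℝ} (hx : 64 ≤ x) (hc : 0 < c) (hc2 : c ≤ 1 / 2) :
    1 ≤ x * Real.exp (-(c / 80 * Real.sqrt (Real.log x))) := by
  have hx0 : 0 < x := by linarith
  have hx1 : 1 ≤ x := by linarith
  set lam := Real.sqrt (Real.log x) with hlam
  have hlx : Real.log x = lam ^ 2 := (Real.sq_sqrt (Real.log_nonneg hx1)).symm
  have : x * Real.exp (-(c / 80 * lam)) = Real.exp (lam ^ 2 + -(c / 80 * lam)) := by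
    rw [Real.exp_add, ← hlx, Real.exp_log hx0]
  rw [this]
  refine Real.one_le_exp ?_
  obtain ⟨hlam2, -⟩ := diff_params hx (by linarith : x / 2 ≤ x)
  nlinarith

/-- Final arithmetic of the differencing: `(5/4 + 20AC)xu + 3 ≤ (5 + 20A)(C+1)xu` when
`xu ≥ 1`, `A, C ≥ 0`. [folklore] -/
theorem diff_final_le {A C xu P : ℝ} (hA : 0 ≤ A) (hC : 0 ≤ C) (hxu : 1 ≤ xu)
    (hP : P ≤ (5 / 4 + 20 * A * C) * xu + 3) : P ≤ (5 + 20 * A) * (C + 1) * xu := by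
  have h1 : (5 / 4 + 20 * A * C) + 3 ≤ (5 + 20 * A) * (C + 1) := by nlinarith
  have h0 : 0 ≤ 5 / 4 + 20 * A * C := by positivity
  nlinarith

/-- **The `ψ`-estimate with an exceptional zero, uniform in the level** (MV Theorem 11.16 with
Cor. 11.17 (11.29), abstract form): for every `0 < c ≤ 1/2` there is `A = A(c)` such that under
`ExcPsiData Λ F c C L β α`, for all `x ≥ 64` with `L ≤ √log x`,
`|ψ_Λ(x) − x + α x^β/β| ≤ A (C + 1) x exp(−(c/80)√log x)`.
From the `ψ₁`-estimate by differencing with `h = ½ x e^{−(c/80)√log x}`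
(`ψ` monotone as `Λ ≥ 0`; Taylor for `M₁` with `|M₁''| ≤ 2`).
[cite: MontgomeryVaughan2007, Theorem 11.16 and Corollary 11.17] -/
theorem exists_psi_bound {c : ℝ} (hc : 0 < c) (hc2 : c ≤ 1 / 2) :
    ∃ A : ℝ, 0 < A ∧ ∀ {Λ : ℕ → ℝ} {F : ℂ → ℂ} {C L β α : ℝ}, ExcPsiData Λ F c C L β α →
      ∀ x : ℝ, 64 ≤ x → L ≤ Real.sqrt (Real.log x) →
        |psi Λ x - (x - α * x ^ β / β)| ≤
          A * (C + 1) * x * Real.exp (-(c / 80 * Real.sqrt (Real.log x))) := by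
  obtain ⟨A, hA0, hB⟩ := exists_rieszMean_bound hc hc2
  refine ⟨5 + 20 * A, by positivity, fun {Λ F C L β α} h x hx hLx ↦ ?_⟩
  have hC := h.C_nonneg
  have hΛ := h.nonneg
  have hx0 : 0 < x := by linarith
  have hx1 : 1 ≤ x := by linarith
  set lam : ℝ := Real.sqrt (Real.log x) with hlam
  set κ : ℝ := c / 40 with hκ
  have hκ0 : 0 ≤ κ := by positivity
  have hκ1 : κ ≤ 1 / 80 := by rw [hκ]; linarith
  set u : ℝ := Real.exp (-(c / 80 * lam)) with hu
  have hu0 : 0 < u := Real.exp_pos _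
  have hlam0 : 0 ≤ lam := Real.sqrt_nonneg _
  have hu1 : u ≤ 1 := Real.exp_le_one_iff.2 (by
    have : 0 ≤ c / 80 * lam := by positivity
    linarith)
  have huu : Real.exp (-(κ * lam)) = u * u := by rw [hu, ← Real.exp_add, hκ]; ring_nf
  set hh : ℝ := x * u / 2 with hhh
  have hh0 : 0 < hh := by positivity
  have hhx : hh ≤ x / 2 := by
    have := mul_le_of_le_one_right hx0.le hu1
    rw [hhh]; linarith
  -- the `ψ₁`-errors at `x`, `x + h`, `x − h`
  set E : ℝ := 5 * A * C * x ^ 2 * Real.exp (-(κ * lam)) with hE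
  have herr : ∀ y : ℝ, x / 2 ≤ y → y ≤ 3 * x / 2 →
      |rieszMean Λ y - excMain₁ β α y| ≤ E := by
    intro y hy1 hy2
    obtain ⟨-, hy3, hs, hs2⟩ := diff_params hx hy1
    have hLy : L ≤ 2 * Real.sqrt (Real.log y) := hLx.trans hs2
    have hb := hB h y hy3 hLy
    have heq : rieszMean Λ y - excMain₁ β α y =
        (∑ n ∈ Finset.Ioc 0 ⌊y⌋₊, Λ n * (y - n)) - (y - 1) ^ 2 / 2 + α * betaMain β y := by
      simp only [rieszMean, excMain₁]; ring
    rw [heq]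
    exact err_nearby_le hA0.le hC hx0 hy1 hy2 hs hκ0 hκ1 hb
  have he0 := herr x (by linarith) (by linarith)
  have he1 := herr (x + hh) (by linarith) (by linarith)
  have he2 := herr (x - hh) (by linarith) (by linarith)
  -- Taylor
  have hα := h.α_le
  have hβ := h.β_ge
  have hβ1 := h.β_lt.le
  have ht1 := excMain₁_taylor hβ hβ1 hα hx1 (by linarith : 1 ≤ x + hh)
  have ht2 := excMain₁_taylor hβ hβ1 hα hx1 (by linarith : 1 ≤ x - hh)
  rw [show x + hh - x = hh by ring] at ht1
  rw [show x - hh - x = -hh by ring] at ht2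
  -- differencing
  have hd1 := sub_mul_psi_le hΛ (by linarith : 0 ≤ x + hh) (by linarith : x ≤ x + hh)
  rw [show x + hh - x = hh by ring] at hd1
  have hd2 := rieszMean_sub_le hΛ (by linarith : x - hh ≤ x)
  rw [show x - (x - hh) = hh by ring] at hd2
  have hup := diff_upper hh0 hd1 he1 he0 ht1
  have hlo := diff_lower hh0 hd2 he2 he0 ht2
  -- sizes: `(5/2)h + 2E/h = (5/4 + 20AC) x u`
  have hsize : 5 / 2 * hh + 2 * E / hh = (5 / 4 + 20 * A * C) * (x * u) := by
    rw [hE, huu, hhh]; exact diff_sizes_eq hx0 hu0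
  rw [hsize] at hup hlo
  have habs : |psi Λ x - excMain β α x| ≤ (5 / 4 + 20 * A * C) * (x * u) := abs_le.2 ⟨hlo, hup⟩
  -- the constant `1 − α/β` and `1 ≤ x u`
  have hconst := abs_excMain_sub_le (x := x) hβ hα
  have hxu1 : 1 ≤ x * u := one_le_mul_exp_neg hx hc hc2
  -- conclusion
  have htri : |psi Λ x - (x - α * x ^ β / β)| ≤ (5 / 4 + 20 * A * C) * (x * u) + 3 :=
    calc |psi Λ x - (x - α * x ^ β / β)|
        ≤ |psi Λ x - excMain β α x| + |excMain β α x - (x - α * x ^ β / β)| := abs_sub_le _ _ _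
      _ ≤ (5 / 4 + 20 * A * C) * (x * u) + 3 := add_le_add habs hconst
  have hfin := diff_final_le hA0.le hC hxu1 htri
  calc |psi Λ x - (x - α * x ^ β / β)| ≤ (5 + 20 * A) * (C + 1) * (x * u) := hfin
    _ = (5 + 20 * A) * (C + 1) * x * Real.exp (-(c / 80 * lam)) := by rw [hu]; ring

end ExcPsiData

end Literature.NumberTheory.LFunctions
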